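import Mathlib.MeasureTheory.Measure.Stieltjes
import Mathlib.MeasureTheory.Measure.Lebesgue.Basic
import Mathlib.Topology.EMetricSpace.BoundedVariation
import Mathlib.Topology.EMetricSpace.Lipschitz
import Mathlib.Probability.Process.Adapted
import Mathlib.Analysis.Calculus.IteratedDeriv.Defs
import Mathlib.Analysis.Calculus.ContDiff.Defs
import Mathlib.Analysis.SpecialFunctions.Sqrt
import Mathlib.MeasureTheory.Integral.IntervalIntegral.Basic
import Mathlib.Analysis.Calculus.ContDiff.Comp
import Mathlib.Analysis.Calculus.Deriv.Prod
import Mathlib.Analysis.Calculus.Deriv.Comp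
import Mathlib.Analysis.Calculus.Deriv.Mul
import Mathlib.Analysis.SpecificLimits.Basic
import Mathlib.MeasureTheory.Integral.DominatedConvergence
import Mathlib.MeasureTheory.Function.LocallyIntegrable
import Mathlib.MeasureTheory.Function.Floor
import Mathlib.MeasureTheory.Constructions.BorelSpace.Metrizable
import Mathlib.MeasureTheory.Constructions.Polish.StronglyMeasurable
import Literature.Probability.Process.ItoCalculus
import Literature.Probability.RandomPlanarGeometry.LocalMartingale
import Literature.Probability.Process.BrownianMotion
import Literature.Probability.RandomPlanarGeometry.LoewnerChain
import Literature.Probability.RandomPlanarGeometry.SLE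
import HarnessLib

-- provenance: harness21/H21/H21/Prelude/AnalysisL/ItoProcesses.lean @ bb6e84b (interim HEAD d8f2665); M5 mechanical rewrite
/-!
# Itô processes, SDEs, Bessel processes and the SLE–Bessel bridge (trunk `AnalysisL`, P6)

This file extends the interface layer of Itô calculus of `Literature.Prelude.Stoch.ItoCalculus`
(integrator: the canonical Brownian motion, time integrals `ds`) in four directions, all at the
*statement* level (definitions are real; theorems from the literature are recorded as **named
facts** `def <name> : Prop := <statement>`, without proof, to be taken as hypotheses
`(h : <name> …)` downstream):

1. **Continuous local martingale integrators.** For an increasing process `A` (typically the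
   quadratic variation `⟨M⟩` of a continuous local martingale `M`) the pathwise
   Lebesgue–Stieltjes measure `Literature.pathMeasure A ω` on `ℝ` (Mathlib's
   `Monotone.stieltjesFunction` and `StieltjesFunction.measure`); the approximation mode
   `Literature.Probability.Process.SimpleProcess.IsApproxSeqWrt` (`∫₀ᵗ (Hₙ - H)² d⟨M⟩ → 0` in probability) and the
   characterising predicate `Literature.IsStochasticIntegral H M A J 𝓕 P` of `J = ∫₀ H dM`
   (Revuz–Yor IV (2.7)–(2.13)); existence of `⟨M⟩` (RY IV Thm (1.8)), consistency with
   `Literature.Probability.Process.IsItoIntegral` for Brownian motion, uniqueness, existence, Kunita–Watanabe.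
2. **Continuous semimartingales.** `Literature.Analysis.FunctionSpaces.IsFiniteVariationProcess` (Mathlib's
   `LocallyBoundedVariationOn` pathwise), `Literature.Analysis.FunctionSpaces.IsContSemimartingale` and uniqueness of the
   decomposition `X = X₀ + M + A`.
3. **Itô processes** `X = X₀ + ∫₀ b ds + ∫₀ σ dB` (`Literature.Analysis.FunctionSpaces.IsItoProcess`) and Itô's formula for
   `C²` functions `f(t, Xₜ)` of an Itô process driven by the canonical Brownian motion
   (Itô 1951; RY IV Thm (3.3)). The original packaging `Literature.Analysis.FunctionSpaces.ito_formula_itoProcess` is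
   **mis-stated** (false as written: the diffusion coefficient is not forced to have measurable
   paths, see its docstring), **refuted in tree**
   (`Literature.Analysis.FunctionSpaces.not_ito_formula_itoProcess`,
   `ItoFormulaItoProcessRefutation.lean`) and, since the named-fact verdict clean-up of
   2026-08-15, a `@[deprecated]` record retired from the literature debt (see the section
   "Verdict clean-up" below); the corrected statement is
   `Literature.Analysis.FunctionSpaces.ito_formula_itoProcess_of_progressive` (extra hypothesis: `σ` progressively measurable,
   Revuz–Yor's standing assumption), reduced in the proof layer at the end of the file to
   `Literature.Probability.Process.exists_isItoIntegral` and the integrated form `Literature.Analysis.FunctionSpaces.ito_formula_itoProcess_ae`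
   (`Literature.Analysis.FunctionSpaces.ito_formula_itoProcess_of_progressive_of_facts`) and proved
   downstream (`Literature.Analysis.FunctionSpaces.ito_formula_itoProcess_of_progressive_holds`,
   `ItoFormulaProgressive.lean`).
4. **SDEs and Bessel processes.** Strong solutions (`Literature.Analysis.FunctionSpaces.IsStrongSolution`, RY IX Def. (1.2)),
   Itô's existence-and-pathwise-uniqueness theorem under Lipschitz coefficients (RY IX
   Thm (2.1)), squared Bessel / Bessel processes as strong solutions of
   `dZ = δ dt + 2√|Z| dB` (RY XI Def. (1.1)), Yamada–Watanabe well-posedness and the dimension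
   dichotomy (`δ ≥ 2`: never hits `0`; `δ < 2`: hits `0`), and the **SLE–Bessel bridge**:
   for chordal SLE_κ, `(gₜ(x) - Wₜ)/√κ` is a Bessel process of dimension `1 + 4/κ` up to the
   swallowing time of `x`, whence real points are swallowed a.s. iff `κ > 4`
   (Rohde–Schramm 2005 §4, §6; Lawler 2005 §6.2).

## Mathlib status

Mathlib (pinned commit) has Stieltjes measures for monotone functions on general linear orders
(`Monotone.stieltjesFunction`, `StieltjesFunction.measure`), (locally) bounded variation
(`LocallyBoundedVariationOn`), `LipschitzWith`, interval integrals, `ContDiff`, `iteratedDeriv`,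
filtrations / `Adapted` / `IsStronglyProgressive`, and real Brownian motion
(`ProbabilityTheory.IsBrownianReal`), but no quadratic variation, stochastic integral,
semimartingale, SDE or Bessel process (`rg -i 'semimartingale|StrongSolution|Bessel process'`
in `Mathlib/Probability` gives nothing). Everything below is therefore new and builds on the
accepted H21 preludes `Stoch.ItoCalculus` (`HasQuadraticVariation`, `SimpleProcess`,
`IsApproxSeq`, `TendstoUCP`, `IsItoIntegral`), `Stoch.LocalMartingale` (`IsLocalMartingale`),
`Stoch.BrownianMotion` (`brownian`, `preWienerMeasure`), `Stoch.LoewnerChain` (`Loewner.map`,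
`Loewner.swallowingTime`) and `Stoch.SLE` (`sleDriving`).

## Design choices

* `pathMeasure A ω : Measure ℝ` is the Stieltjes measure of the path `s ↦ A (s⁺) ω` extended
  constantly (`= A 0 ω`) to negative times, when this path is monotone, and the **junk value
  `0`** otherwise (documented; for a `HasQuadraticVariation` process the junk branch has
  probability `0`). Time integrals `∫₀ᵗ … d⟨M⟩` are `∫⁻ s in Set.Icc (0:ℝ) t, … ∂(pathMeasure A ω)`,
  exactly parallel to G15's `∫⁻ s in Set.Icc (0:ℝ) t, …` for `ds`; for `A t = t` the two agree
  (`pathMeasure_const_id`, `SimpleProcess.isApproxSeqWrt_const_iff`).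
* `IsStochasticIntegral` copies the shape of G15's `IsItoIntegral` and *adds* the conjunct
  `HasQuadraticVariation M A 𝓕 P` tying `A` to `M`; the named fact
  `IsLocalMartingale.exists_hasQuadraticVariation 𝓕 P` (RY IV Thm (1.8)) says this conjunct is
  satisfiable for every continuous local martingale vanishing at `0`.
* Named facts generic in the probability space take the filtration and the measure as explicit
  arguments (`<name> 𝓕 P : Prop`, fixing `Ω`) and quantify processes and hypotheses inside, so
  that one witness serves all processes; facts about the canonical Brownian motion
  (`brownian`, `brownianFiltration`, `preWienerMeasure`) are closed `Prop`s.
  `isStochasticIntegral_iff_isItoIntegral` takes the upstream named fact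
  `Literature.Probability.RandomPlanarGeometry.martingale_brownian_sq_sub` (`Bₜ² - t` is a martingale) as a hypothesis, through
  `hasQuadraticVariation_brownian`.
* As in G15 we work with raw (uncompleted, not right-continuous) filtrations; existence theorems
  assert a.s.-continuous versions adapted to the given filtration (Revuz–Yor work under the usual
  conditions; labels of the raw-filtration versions are marked '?').
* Theorems about Bessel processes driven by a general `B` on `(Ω, 𝓕, P)` assume that `B` is an
  `𝓕`-Brownian motion in Lévy's form: a continuous `𝓕`-local martingale with `B₀ = 0` and
  `⟨B⟩ₜ = t` (`HasQuadraticVariation B (fun t _ ↦ t) 𝓕 P`), cf. `Literature.Probability.Process.levy_characterisation`.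
* Real points `x : ℝ` are fed to the Loewner objects through the coercion `ℝ → ℂ`
  (`Loewner.map W t x` is total, junk value `x` after swallowing — never used here since the SLE
  statements are guarded by `t < swallowingTime`).

## Verdict clean-up (2026-08-15): `ito_formula_itoProcess` is a refuted record, not a named fact

`ito_formula_itoProcess` had been vendored in named-fact form (a closed `Prop` carrying a citation
tag) and therefore counted as literature debt awaiting a `_holds` theorem. Its prove-seat
concluded that no such theorem can exist — the statement is FALSE as written — and proved the
negation; the verdict was re-verified for this clean-up against the tree and against the held
text of Revuz–Yor (3rd ed.), Ch. IV: Def. (2.1) ("we call `𝓛²(M)` the space of progressively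
measurable processes `K` such that …") and Def. (2.6) (`L²_loc(M)`: "classes of progressively
measurable processes `K` …") make progressive measurability of the integrand a standing
hypothesis of every stochastic integral appearing in Thm (3.3), whereas the Lean statement
constrains `σ` only through `IsItoIntegral σ B J`, whose approximation clause is blind to
modifications of `σ` on a set of times of inner measure zero
(`SimpleProcess.IsApproxSeq.of_forall_measurableSet_subset_null` below). Outcome — RETIRED AS A
FACT (refuted):
* the refutation is the unconditional theorem
  `Literature.Analysis.FunctionSpaces.not_ito_formula_itoProcess : ¬ ito_formula_itoProcess`
  (`ItoFormulaItoProcessRefutation.lean`; axioms `propext`, `Classical.choice`, `Quot.sound`);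
* the corrected statement (Thm (3.3) with the source's standing hypothesis on `σ`) is
  `ito_formula_itoProcess_of_progressive` below, PROVED downstream
  (`ito_formula_itoProcess_of_progressive_holds`, `ItoFormulaProgressive.lean`);
* the old definition is kept VERBATIM (statement unchanged) because its refutation must name it,
  and is `@[deprecated]` with a pointer to both; the refutation switches `linter.deprecated` off
  for itself alone. Never take `(h : ito_formula_itoProcess)` as a hypothesis (it is refutable,
  so anything follows). The vacuous weakening lemma `ito_formula_itoProcess_of_progressive_of`
  (`ito_formula_itoProcess → ito_formula_itoProcess_of_progressive`; no users) was removed with it.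
No statement of this file changed.

## References

* K. Itô, *On stochastic differential equations*, Mem. Amer. Math. Soc. 4 (1951).
* D. Revuz, M. Yor, *Continuous Martingales and Brownian Motion* (3rd ed., 1999), Ch. IV
  §§1–3, Ch. IX §§1–3, Ch. XI §1.
* T. Yamada, S. Watanabe, *On the uniqueness of solutions of stochastic differential
  equations*, J. Math. Kyoto Univ. 11 (1971).
* S. Rohde, O. Schramm, *Basic properties of SLE*, Ann. of Math. 161 (2005), §4, §6.
* G. Lawler, *Conformally Invariant Processes in the Plane* (2005), §1.10 (Bessel), §6.2.
-/

open MeasureTheory ProbabilityTheory Filter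
open scoped NNReal ENNReal Topology

noncomputable section

namespace Literature.Analysis.FunctionSpaces

variable {Ω : Type*} {m : MeasurableSpace Ω}

/-! ### Pathwise Lebesgue–Stieltjes measures of increasing processes -/

open Classical in
/-- The **pathwise Lebesgue–Stieltjes measure** `dA(ω)` on `ℝ` of a real process
`A : ℝ≥0 → Ω → ℝ` at the sample point `ω`: if the path `s ↦ A s⁺ ω` (extended by `A 0 ω` on
`(-∞, 0)`, via `Real.toNNReal`) is monotone, it is the Stieltjes measure of (the right-continuous
regularisation of) this path (Mathlib's `Monotone.stieltjesFunction`, `StieltjesFunction.measure`);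
otherwise the **junk value `0`**. It carries no mass on `(-∞, 0)` (`pathMeasure_Iio_zero`), and
`pathMeasure A ω (Set.Icc 0 t) = A t⁺ ω - A 0 ω`; in particular a jump `A 0⁺ ω ≠ A 0 ω` of the
path at `0` puts an atom at `0` (part of the junk-value contract; irrelevant for the
a.s.-continuous processes `A` used below). Used with `A = ⟨M⟩` to write `∫₀ᵗ H² d⟨M⟩`.
Revuz–Yor, *Continuous Martingales and Brownian Motion* (1999), Ch. IV, §1 (after
Thm (1.8)) and Ch. 0, §4 (Stieltjes integrals). [folklore] -/
def pathMeasure (A : ℝ≥0 → Ω → ℝ) (ω : Ω) : Measure ℝ :=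
  if h : Monotone (fun s : ℝ ↦ A s.toNNReal ω) then h.stieltjesFunction.measure else 0

/-- For the deterministic increasing process `A t = t` the pathwise Stieltjes measure is Lebesgue
measure restricted to `[0, ∞)` (the path is `s ↦ max s 0`, continuous, so no regularisation and
no atom at `0`).
Revuz–Yor, *Continuous Martingales and Brownian Motion* (1999), Ch. 0, §4. [folklore] -/
theorem pathMeasure_const_id (ω : Ω) :
    pathMeasure (fun (t : ℝ≥0) (_ : Ω) ↦ (t : ℝ)) ω = volume.restrict (Set.Ici 0) := by
  have hmono : Monotone (fun s : ℝ ↦ ((s.toNNReal : ℝ≥0) : ℝ)) :=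
    fun _ _ h ↦ NNReal.coe_le_coe.2 (Real.toNNReal_le_toNNReal h)
  unfold pathMeasure
  rw [dif_pos hmono]
  have hF : ∀ s : ℝ, hmono.stieltjesFunction s = max s 0 := fun s ↦ by
    rw [Monotone.stieltjesFunction_eq, ContinuousWithinAt.rightLim_eq, Real.coe_toNNReal']
    exact (NNReal.continuous_coe.comp continuous_real_toNNReal).continuousWithinAt
  refine Measure.ext_of_Ioc _ _ fun a b hab ↦ ?_
  rw [StieltjesFunction.measure_Ioc, hF, hF, Measure.restrict_apply measurableSet_Ioc]
  rcases le_or_gt 0 a with ha | ha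
  · rw [Set.inter_eq_left.2 (fun x hx ↦ Set.mem_Ici.2 (ha.trans hx.1.le)), Real.volume_Ioc,
      max_eq_left ha, max_eq_left (ha.trans hab.le)]
  · rw [max_eq_right ha.le, sub_zero]
    rcases le_or_gt 0 b with hb | hb
    · have : Set.Ioc a b ∩ Set.Ici 0 = Set.Icc 0 b := by
        ext x
        simp only [Set.mem_inter_iff, Set.mem_Ioc, Set.mem_Ici, Set.mem_Icc]
        exact ⟨fun ⟨⟨_, h2⟩, h3⟩ ↦ ⟨h3, h2⟩, fun ⟨h1, h2⟩ ↦ ⟨⟨ha.trans_le h1, h2⟩, h1⟩⟩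
      rw [this, Real.volume_Icc, max_eq_left hb, sub_zero]
    · have : Set.Ioc a b ∩ Set.Ici 0 = ∅ := by
        ext x
        simp only [Set.mem_inter_iff, Set.mem_Ioc, Set.mem_Ici, Set.mem_empty_iff_false,
          iff_false]
        exact fun ⟨⟨_, h2⟩, h3⟩ ↦ (not_le.2 hb (h3.trans h2)).elim
      rw [this, measure_empty, max_eq_right hb.le, ENNReal.ofReal_zero]

/-- `pathMeasure` gives no mass to the negative half-line (the extended path is
constant there).
Revuz–Yor, *Continuous Martingales and Brownian Motion* (1999), Ch. 0, §4. [folklore] -/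
theorem pathMeasure_Iio_zero (A : ℝ≥0 → Ω → ℝ) (ω : Ω) : pathMeasure A ω (Set.Iio 0) = 0 := by
  unfold pathMeasure
  split_ifs with h
  · -- the regularised path equals `A 0 ω` on `(-∞, 0)`
    have hF : ∀ s < (0 : ℝ), h.stieltjesFunction s = A 0 ω := by
      intro s hs
      rw [Monotone.stieltjesFunction_eq]
      refine rightLim_eq_of_tendsto (tendsto_const_nhds.congr' ?_)
      filter_upwards [Ioo_mem_nhdsGT hs] with u hu
      simp [Real.toNNReal_of_nonpos hu.2.le]
    have hbot : Tendsto h.stieltjesFunction atBot (𝓝 (A 0 ω)) :=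
      tendsto_const_nhds.congr' (by
        filter_upwards [Iio_mem_atBot (0 : ℝ)] with s hs using (hF s hs).symm)
    have hleft : Function.leftLim h.stieltjesFunction 0 = A 0 ω :=
      leftLim_eq_of_tendsto (tendsto_const_nhds.congr' (by
        filter_upwards [self_mem_nhdsWithin] with s hs using (hF s hs).symm))
    rw [StieltjesFunction.measure_Iio _ hbot, hleft, sub_self, ENNReal.ofReal_zero]
  · rfl

section SimpleProcess
open Literature.Probability.Process (SimpleProcess)
open Literature.Probability.Process.SimpleProcess

variable {𝓕 : Filtration ℝ≥0 m}

/-- A sequence `Hn` of simple processes **approximates** the integrand `H` **with respect to the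
increasing process `A`** (in `L²_loc(dA)` in probability) under `P`: for every `t` and `ε > 0`,
`P (∫₀ᵗ (Hₙ(s) - H(s))² dA_s ≥ ε) → 0`. The time integral is the extended integral over
`[0, t] ⊆ ℝ` against `pathMeasure A ω`. For `A t = t` this is G15's `IsApproxSeq`
(`isApproxSeqWrt_const_iff`).
Revuz–Yor, *Continuous Martingales and Brownian Motion* (1999), Ch. IV, Def. (2.7)–(2.9) and
Prop. (2.13) (`L²_loc(M)`). [folklore] -/
def _root_.Literature.Probability.Process.SimpleProcess.IsApproxSeqWrt (Hn : ℕ → SimpleProcess m 𝓕) (H A : ℝ≥0 → Ω → ℝ) (P : Measure Ω) : Prop :=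
  ∀ (t : ℝ≥0) (ε : ℝ), 0 < ε →
    Tendsto (fun n ↦ P {ω | ENNReal.ofReal ε ≤
      ∫⁻ s in Set.Icc (0 : ℝ) t,
        ENNReal.ofReal (((Hn n).toProcess s.toNNReal ω - H s.toNNReal ω) ^ 2) ∂(pathMeasure A ω)})
      atTop (𝓝 0)

/-- Approximation with respect to `A t = t` is G15's approximation in `L²_loc(ds)`.
Revuz–Yor, *Continuous Martingales and Brownian Motion* (1999), Ch. IV, Def. (2.9). [folklore] -/
theorem _root_.Literature.Probability.Process.SimpleProcess.isApproxSeqWrt_const_iff {Hn : ℕ → SimpleProcess m 𝓕} {H : ℝ≥0 → Ω → ℝ}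
    {P : Measure Ω} :
    IsApproxSeqWrt Hn H (fun (t : ℝ≥0) (_ : Ω) ↦ (t : ℝ)) P ↔ IsApproxSeq Hn H P := by
  simp only [IsApproxSeqWrt, IsApproxSeq, pathMeasure_const_id,
    Measure.restrict_restrict measurableSet_Icc, Set.inter_eq_left.2 Set.Icc_subset_Ici_self]

end SimpleProcess

/-! ### Stochastic integrals against continuous local martingales -/

/-- `IsStochasticIntegral H M A J 𝓕 P`: the process `J` **is the stochastic integral**
`∫₀ H dM` of `H` against the continuous local martingale `M` with quadratic variation `A = ⟨M⟩`.
Characterisation, not construction: `A` is a quadratic variation of `M`; `J` vanishes at `0`, is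
a.s. continuous and a local martingale; `H` admits at least one sequence of bounded simple
approximants in `L²_loc(d⟨M⟩)` in probability; and along *every* such sequence the elementary
integrals `(Hₙ · M)` converge to `J` uniformly on compacts in probability.
Revuz–Yor, *Continuous Martingales and Brownian Motion* (1999), Ch. IV, (2.7)–(2.13). [folklore] -/
def IsStochasticIntegral (H M A J : ℝ≥0 → Ω → ℝ) (𝓕 : Filtration ℝ≥0 m) (P : Measure Ω) :
    Prop :=
  Literature.Probability.Process.HasQuadraticVariation M A 𝓕 P ∧ (∀ ω, J 0 ω = 0) ∧ (∀ᵐ ω ∂P, Continuous (J · ω)) ∧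
    Literature.Probability.RandomPlanarGeometry.IsLocalMartingale J 𝓕 P ∧
    (∃ Hn : ℕ → Literature.Probability.Process.SimpleProcess m 𝓕, Literature.Probability.Process.SimpleProcess.IsApproxSeqWrt Hn H A P) ∧
    ∀ Hn : ℕ → Literature.Probability.Process.SimpleProcess m 𝓕, Literature.Probability.Process.SimpleProcess.IsApproxSeqWrt Hn H A P →
      Literature.Probability.Process.TendstoUCP (fun n ↦ (Hn n).integral M) J P

section StochasticIntegral

variable {H M A J : ℝ≥0 → Ω → ℝ} {𝓕 : Filtration ℝ≥0 m} {P : Measure Ω}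

/-- A stochastic integral comes with a quadratic variation of its integrator (by definition).
Revuz–Yor, *Continuous Martingales and Brownian Motion* (1999), Ch. IV, (2.7). [folklore] -/
theorem IsStochasticIntegral.hasQuadraticVariation (h : IsStochasticIntegral H M A J 𝓕 P) :
    Literature.Probability.Process.HasQuadraticVariation M A 𝓕 P :=
  h.1

/-- A stochastic integral vanishes at time `0` (by definition).
Revuz–Yor, *Continuous Martingales and Brownian Motion* (1999), Ch. IV, Thm (2.2). [folklore] -/
theorem IsStochasticIntegral.apply_zero (h : IsStochasticIntegral H M A J 𝓕 P) (ω : Ω) :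
    J 0 ω = 0 :=
  h.2.1 ω

/-- A stochastic integral has a.s. continuous paths (by definition).
Revuz–Yor, *Continuous Martingales and Brownian Motion* (1999), Ch. IV, Thm (2.2). [folklore] -/
theorem IsStochasticIntegral.continuous (h : IsStochasticIntegral H M A J 𝓕 P) :
    ∀ᵐ ω ∂P, Continuous (J · ω) :=
  h.2.2.1

/-- A stochastic integral against a continuous local martingale is a local martingale
(by definition).
Revuz–Yor, *Continuous Martingales and Brownian Motion* (1999), Ch. IV, Prop. (2.10). [folklore] -/
theorem IsStochasticIntegral.isLocalMartingale (h : IsStochasticIntegral H M A J 𝓕 P) :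
    Literature.Probability.RandomPlanarGeometry.IsLocalMartingale J 𝓕 P :=
  h.2.2.2.1

/-- **Existence of the quadratic variation** of a continuous local martingale vanishing at `0`:
there is an adapted, a.s. continuous increasing process `A` with `A 0 = 0` and `M² - A` a local
martingale. (For a raw filtration an adapted a.s.-continuous version is meant; label '?'.)
This de-vacuifies the `HasQuadraticVariation` conjunct of `IsStochasticIntegral`. Named fact
(no proof here), `𝓕`, `P` explicit and the local martingale quantified inside.
Revuz–Yor, *Continuous Martingales and Brownian Motion* (1999), Ch. IV, Thm (1.8). [cite: RevuzYor1999, Ch. IV Thm (1.8)] -/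
def _root_.Literature.Probability.RandomPlanarGeometry.IsLocalMartingale.exists_hasQuadraticVariation (𝓕 : Filtration ℝ≥0 m) (P : Measure Ω) :
    Prop :=
  ∀ ⦃M : ℝ≥0 → Ω → ℝ⦄ [IsProbabilityMeasure P], Literature.Probability.RandomPlanarGeometry.IsLocalMartingale M 𝓕 P →
    (∀ ω, M 0 ω = 0) → (∀ᵐ ω ∂P, Continuous (M · ω)) → ∃ A, Literature.Probability.Process.HasQuadraticVariation M A 𝓕 P

/-- **Consistency with the Brownian Itô integral, general form**: if `⟨M⟩ₜ = t` then
`IsStochasticIntegral H M (fun t _ ↦ t) J 𝓕 P ↔ IsItoIntegral H M J 𝓕 P` (the approximation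
modes coincide by `SimpleProcess.isApproxSeqWrt_const_iff`).
Revuz–Yor, *Continuous Martingales and Brownian Motion* (1999), Ch. IV, Def. (2.9) vs (2.7). [folklore] -/
theorem isStochasticIntegral_iff_isItoIntegral_of_hasQuadraticVariation
    (hq : Literature.Probability.Process.HasQuadraticVariation M (fun (t : ℝ≥0) (_ : Ω) ↦ (t : ℝ)) 𝓕 P) :
    IsStochasticIntegral H M (fun (t : ℝ≥0) (_ : Ω) ↦ (t : ℝ)) J 𝓕 P ↔
      Literature.Probability.Process.IsItoIntegral H M J 𝓕 P := by
  simp only [IsStochasticIntegral, Literature.Probability.Process.IsItoIntegral, Literature.Probability.Process.SimpleProcess.isApproxSeqWrt_const_iff, hq,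
    true_and]

/-- **Consistency with the Brownian Itô integral**: for the canonical Brownian motion
(`⟨B⟩ₜ = t`, `hasQuadraticVariation_brownian`) the stochastic integral of this file is exactly
G15's `IsItoIntegral`. The martingale property of `Bₜ² - t` is the upstream named fact
`Literature.Probability.RandomPlanarGeometry.martingale_brownian_sq_sub`, taken as the hypothesis `hM`.
Revuz–Yor, *Continuous Martingales and Brownian Motion* (1999), Ch. IV, Def. (2.9) vs (2.7). [folklore] -/
theorem isStochasticIntegral_iff_isItoIntegral (hM : Literature.Probability.RandomPlanarGeometry.martingale_brownian_sq_sub)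
    {H J : ℝ≥0 → (ℝ≥0 → ℝ) → ℝ} :
    IsStochasticIntegral H Literature.Probability.Process.brownian (fun (t : ℝ≥0) _ ↦ (t : ℝ)) J Literature.Probability.RandomPlanarGeometry.brownianFiltration
        Literature.Probability.Process.preWienerMeasure ↔
      Literature.Probability.Process.IsItoIntegral H Literature.Probability.Process.brownian J Literature.Probability.RandomPlanarGeometry.brownianFiltration Literature.Probability.Process.preWienerMeasure :=
  isStochasticIntegral_iff_isItoIntegral_of_hasQuadraticVariation
    (Literature.Probability.Process.hasQuadraticVariation_brownian hM)

/-- **Uniqueness of the stochastic integral** up to indistinguishability: two stochastic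
integrals of the same integrand against the same `(M, ⟨M⟩)` agree at all times outside a
`P`-null set (u.c.p. limits along a common approximating sequence, both a.s. continuous).
Named fact (no proof here), `𝓕`, `P` explicit and the processes quantified inside.
Revuz–Yor, *Continuous Martingales and Brownian Motion* (1999), Ch. IV, Thm (2.2) and
Prop. (2.13). [cite: RevuzYor1999, Ch. IV Thm (2.2) and Prop. (2.13)] -/
def IsStochasticIntegral.unique (𝓕 : Filtration ℝ≥0 m) (P : Measure Ω) : Prop :=
  ∀ ⦃H M A J J' : ℝ≥0 → Ω → ℝ⦄, IsStochasticIntegral H M A J 𝓕 P →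
    IsStochasticIntegral H M A J' 𝓕 P → ∀ᵐ ω ∂P, ∀ t, J t ω = J' t ω

/-- **Existence of the stochastic integral** `∫₀ H dM` for a continuous local martingale `M`
with quadratic variation `A = ⟨M⟩`, and an integrand `H` progressively measurable
with `∫₀ᵗ H² d⟨M⟩ < ∞` a.s. for every `t` (`H ∈ L²_loc(M)`). Raw-filtration version (an
a.s.-continuous adapted version is meant), label '?'. Named fact (no proof here), `𝓕`, `P`
explicit and the processes quantified inside.
Revuz–Yor, *Continuous Martingales and Brownian Motion* (1999), Ch. IV, Thm (2.2),
Def. (2.7)–(2.9), Prop. (2.10), Prop. (2.13). [cite: RevuzYor1999, Ch. IV Thm (2.2) and Prop. (2.13)] -/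
def exists_isStochasticIntegral (𝓕 : Filtration ℝ≥0 m) (P : Measure Ω) : Prop :=
  ∀ ⦃H M A : ℝ≥0 → Ω → ℝ⦄ [IsProbabilityMeasure P], Literature.Probability.RandomPlanarGeometry.IsLocalMartingale M 𝓕 P →
    (∀ᵐ ω ∂P, Continuous (M · ω)) → Literature.Probability.Process.HasQuadraticVariation M A 𝓕 P →
    IsStronglyProgressive 𝓕 H →
    (∀ᵐ ω ∂P, ∀ t : ℝ≥0,
      ∫⁻ s in Set.Icc (0 : ℝ) t, ENNReal.ofReal (H s.toNNReal ω ^ 2) ∂(pathMeasure A ω) < ∞) →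
    ∃ J, IsStochasticIntegral H M A J 𝓕 P

/-- The **Kunita–Watanabe inequality**, in polarised form avoiding signed path measures: if
`A = ⟨M⟩`, `A' = ⟨N⟩` and `Q = ⟨M + N⟩` (so that `⟨M, N⟩ = ½ (Q - A - A')`), then for locally
bounded Borel integrands `H, K` (deterministic functions of time here applied pathwise), a.s.
for all `t`,
`|∫₀ᵗ H K d⟨M,N⟩| ≤ (∫₀ᵗ H² d⟨M⟩)^{1/2} (∫₀ᵗ K² d⟨N⟩)^{1/2}`, i.e.
`|∫ HK dQ - ∫ HK dA - ∫ HK dA'| ≤ 2 √(∫ H² dA) √(∫ K² dA')`. No normalisation `M₀ = N₀ = 0`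
is needed (the path measures only see increments). Named fact (no proof here), `𝓕`, `P`
explicit and the processes and integrands quantified inside.
H. Kunita, S. Watanabe, Nagoya Math. J. 30 (1967); Revuz–Yor, *Continuous Martingales and
Brownian Motion* (1999), Ch. IV, Prop. (1.15) and Cor. (1.16). [cite: RevuzYor1999, Ch. IV Prop. (1.15) and Cor. (1.16)] -/
def kunita_watanabe (𝓕 : Filtration ℝ≥0 m) (P : Measure Ω) : Prop :=
  ∀ ⦃H K M N A A' Q : ℝ≥0 → Ω → ℝ⦄ [IsProbabilityMeasure P], Literature.Probability.RandomPlanarGeometry.IsLocalMartingale M 𝓕 P →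
    Literature.Probability.RandomPlanarGeometry.IsLocalMartingale N 𝓕 P → (∀ᵐ ω ∂P, Continuous (M · ω)) →
    (∀ᵐ ω ∂P, Continuous (N · ω)) → Literature.Probability.Process.HasQuadraticVariation M A 𝓕 P →
    Literature.Probability.Process.HasQuadraticVariation N A' 𝓕 P →
    Literature.Probability.Process.HasQuadraticVariation (fun t ω ↦ M t ω + N t ω) Q 𝓕 P →
    (∀ ω, Measurable fun s : ℝ ↦ H s.toNNReal ω) →
    (∀ ω, Measurable fun s : ℝ ↦ K s.toNNReal ω) →
    (∀ ω (t : ℝ≥0), ∃ C, ∀ s ≤ t, |H s ω| ≤ C) →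
    (∀ ω (t : ℝ≥0), ∃ C, ∀ s ≤ t, |K s ω| ≤ C) →
    ∀ᵐ ω ∂P, ∀ t : ℝ≥0,
      |(∫ s in Set.Icc (0 : ℝ) t, H s.toNNReal ω * K s.toNNReal ω ∂(pathMeasure Q ω)) -
          (∫ s in Set.Icc (0 : ℝ) t, H s.toNNReal ω * K s.toNNReal ω ∂(pathMeasure A ω)) -
          ∫ s in Set.Icc (0 : ℝ) t, H s.toNNReal ω * K s.toNNReal ω ∂(pathMeasure A' ω)| ≤
        2 * Real.sqrt (∫ s in Set.Icc (0 : ℝ) t, H s.toNNReal ω ^ 2 ∂(pathMeasure A ω)) *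
          Real.sqrt (∫ s in Set.Icc (0 : ℝ) t, K s.toNNReal ω ^ 2 ∂(pathMeasure A' ω))

end StochasticIntegral

/-! ### Finite-variation processes and continuous semimartingales -/

/-- `IsFiniteVariationProcess A 𝓕 P`: `A` is an `𝓕`-adapted process with `A 0 = 0` whose paths
are, almost surely, continuous and of locally bounded variation on `[0, ∞)` (Mathlib's
`LocallyBoundedVariationOn`; on `ℝ≥0`, `Set.Ici 0 = univ`).
Revuz–Yor, *Continuous Martingales and Brownian Motion* (1999), Ch. IV, Def. (1.1) and
Def. (1.17). [folklore] -/
def IsFiniteVariationProcess (A : ℝ≥0 → Ω → ℝ) (𝓕 : Filtration ℝ≥0 m) (P : Measure Ω) : Prop :=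
  Adapted 𝓕 A ∧ (∀ ω, A 0 ω = 0) ∧
    ∀ᵐ ω ∂P, Continuous (A · ω) ∧ LocallyBoundedVariationOn (fun s : ℝ≥0 ↦ A s ω) (Set.Ici 0)

/-- `IsContSemimartingale X 𝓕 P`: `X` is a **continuous semimartingale**, i.e. it decomposes as
`X = X₀ + M + A` (for all times, almost surely) with `M` a continuous local martingale vanishing
at `0` and `A` a continuous adapted finite-variation process vanishing at `0`. (Name as
prescribed by the H21 outline; Mathlib style would spell it `IsContinuousSemimartingale`.)
Revuz–Yor, *Continuous Martingales and Brownian Motion* (1999), Ch. IV, Def. (1.17). [folklore] -/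
def IsContSemimartingale (X : ℝ≥0 → Ω → ℝ) (𝓕 : Filtration ℝ≥0 m) (P : Measure Ω) : Prop :=
  ∃ M A : ℝ≥0 → Ω → ℝ, Literature.Probability.RandomPlanarGeometry.IsLocalMartingale M 𝓕 P ∧ (∀ ω, M 0 ω = 0) ∧
    (∀ᵐ ω ∂P, Continuous (M · ω)) ∧ IsFiniteVariationProcess A 𝓕 P ∧
    ∀ᵐ ω ∂P, ∀ t, X t ω = X 0 ω + M t ω + A t ω

section Semimartingale

variable {M A : ℝ≥0 → Ω → ℝ} {𝓕 : Filtration ℝ≥0 m} {P : Measure Ω}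

/-- The finite-variation part of a semimartingale decomposition is adapted (by definition).
Revuz–Yor, *Continuous Martingales and Brownian Motion* (1999), Ch. IV, Def. (1.17). [folklore] -/
theorem IsFiniteVariationProcess.adapted (h : IsFiniteVariationProcess A 𝓕 P) : Adapted 𝓕 A :=
  h.1

/-- A continuous local martingale vanishing at `0` is a continuous semimartingale (`A = 0`).
Revuz–Yor, *Continuous Martingales and Brownian Motion* (1999), Ch. IV, Def. (1.17). [folklore] -/
theorem _root_.Literature.Probability.RandomPlanarGeometry.IsLocalMartingale.isContSemimartingale (hM : Literature.Probability.RandomPlanarGeometry.IsLocalMartingale M 𝓕 P)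
    (h0 : ∀ ω, M 0 ω = 0) (hc : ∀ᵐ ω ∂P, Continuous (M · ω)) : IsContSemimartingale M 𝓕 P := by
  refine ⟨M, 0, hM, h0, hc, ⟨adapted_const' _ _, fun _ ↦ rfl, ae_of_all _ fun ω ↦ ?_⟩, ?_⟩
  · refine ⟨continuous_const, fun a b _ _ h ↦ ?_⟩
    rw [eVariationOn.constant_on] at h
    · exact ENNReal.zero_ne_top h
    · exact (Set.subsingleton_of_forall_eq (0 : ℝ) (by
        rintro _ ⟨_, _, rfl⟩; rfl))
  · exact ae_of_all _ fun ω t ↦ by simp [h0 ω]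

/-- **Uniqueness of the semimartingale decomposition**: if `X = X₀ + M + A = X₀ + M' + A'` with
`M, M'` continuous local martingales and `A, A'` continuous finite-variation processes, all
vanishing at `0`, then `M = M'` and `A = A'` up to indistinguishability (a continuous local
martingale of finite variation is constant). Named fact (no proof here), `𝓕`, `P` explicit and
the processes quantified inside.
Revuz–Yor, *Continuous Martingales and Brownian Motion* (1999), Ch. IV, Prop. (1.2) and
Def. (1.17). [cite: RevuzYor1999, Ch. IV Prop. (1.2) and Def. (1.17)] -/
def IsContSemimartingale.unique_decomp (𝓕 : Filtration ℝ≥0 m) (P : Measure Ω) : Prop :=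
  ∀ ⦃X M M' A A' : ℝ≥0 → Ω → ℝ⦄ [IsProbabilityMeasure P],
    Literature.Probability.RandomPlanarGeometry.IsLocalMartingale M 𝓕 P → (∀ ω, M 0 ω = 0) → (∀ᵐ ω ∂P, Continuous (M · ω)) →
    IsFiniteVariationProcess A 𝓕 P →
    Literature.Probability.RandomPlanarGeometry.IsLocalMartingale M' 𝓕 P → (∀ ω, M' 0 ω = 0) → (∀ᵐ ω ∂P, Continuous (M' · ω)) →
    IsFiniteVariationProcess A' 𝓕 P →
    (∀ᵐ ω ∂P, ∀ t, X t ω = X 0 ω + M t ω + A t ω) →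
    (∀ᵐ ω ∂P, ∀ t, X t ω = X 0 ω + M' t ω + A' t ω) →
    ∀ᵐ ω ∂P, ∀ t, M t ω = M' t ω ∧ A t ω = A' t ω

end Semimartingale

/-! ### Itô processes and Itô's formula -/

/-- `IsItoProcess X b σ B 𝓕 P`: `X` is an **Itô process** with drift `b` and diffusion
coefficient `σ` driven by `B`: almost surely the drift is locally integrable in time, and there
is an Itô integral `J = ∫₀ σ dB` (`IsItoIntegral σ B J 𝓕 P`) such that, almost surely, for all
`t`, `X t = X 0 + ∫₀ᵗ b s ds + J t`. (Designed for `B` a Brownian motion, as `IsItoIntegral`.)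
K. Itô (1951); Revuz–Yor, *Continuous Martingales and Brownian Motion* (1999), Ch. IV, §3
(before Thm (3.3)) and Ch. IX, Def. (1.2). [cite: Ito1951] -/
def IsItoProcess (X b σ B : ℝ≥0 → Ω → ℝ) (𝓕 : Filtration ℝ≥0 m) (P : Measure Ω) : Prop :=
  (∀ᵐ ω ∂P, ∀ t : ℝ≥0, IntegrableOn (fun s : ℝ ↦ b s.toNNReal ω) (Set.Icc 0 t)) ∧
    ∃ J, Literature.Probability.Process.IsItoIntegral σ B J 𝓕 P ∧
      ∀ᵐ ω ∂P, ∀ t : ℝ≥0, X t ω = X 0 ω + (∫ s in (0 : ℝ)..t, b s.toNNReal ω) + J t ω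

section ItoProcess

variable {X b σ B : ℝ≥0 → Ω → ℝ} {𝓕 : Filtration ℝ≥0 m} {P : Measure Ω}

/-- The drift of an Itô process is a.s. locally integrable in time (by definition).
Revuz–Yor, *Continuous Martingales and Brownian Motion* (1999), Ch. IX, Def. (1.2). [folklore] -/
theorem IsItoProcess.integrableOn (h : IsItoProcess X b σ B 𝓕 P) :
    ∀ᵐ ω ∂P, ∀ t : ℝ≥0, IntegrableOn (fun s : ℝ ↦ b s.toNNReal ω) (Set.Icc 0 t) :=
  h.1

/-- An Itô process admits the Itô integral `∫₀ σ dB` of its diffusion coefficient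
(by definition).
Revuz–Yor, *Continuous Martingales and Brownian Motion* (1999), Ch. IX, Def. (1.2). [folklore] -/
theorem IsItoProcess.exists_isItoIntegral (h : IsItoProcess X b σ B 𝓕 P) :
    ∃ J, Literature.Probability.Process.IsItoIntegral σ B J 𝓕 P :=
  h.2.imp fun _ hJ ↦ hJ.1

/-- An Itô integral `J = ∫₀ σ dB` is itself an Itô process with zero drift.
Revuz–Yor, *Continuous Martingales and Brownian Motion* (1999), Ch. IV, §3. [folklore] -/
theorem _root_.Literature.Probability.Process.IsItoIntegral.isItoProcess {J : ℝ≥0 → Ω → ℝ} (h : Literature.Probability.Process.IsItoIntegral σ B J 𝓕 P) :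
    IsItoProcess J 0 σ B 𝓕 P := by
  refine ⟨ae_of_all _ fun ω t ↦ ?_, J, h, ae_of_all _ fun ω t ↦ ?_⟩
  · exact integrableOn_zero
  · simp [h.apply_zero ω]

end ItoProcess

/-- **Deprecated record — REFUTED as stated**
(`Literature.Analysis.FunctionSpaces.not_ito_formula_itoProcess`, `ItoFormulaItoProcessRefutation.lean`;
prove-seat verdict, named-fact verdict clean-up 2026-08-15; never use it as a hypothesis —
anything follows from it). **Replacement:** `ito_formula_itoProcess_of_progressive` (this file,
declared below — hence named in the deprecation message rather than as the attribute's target;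
it adds the single hypothesis `IsStronglyProgressive brownianFiltration σ`), PROVED downstream:
`ito_formula_itoProcess_of_progressive_holds` (`ItoFormulaProgressive.lean`). The statement below
is unchanged and kept only because its refutation names it. *Original content* —
**Itô's formula for Itô processes** driven by the canonical Brownian motion: if
`X = X₀ + ∫ b ds + ∫ σ dB` is *adapted* (to the raw Brownian filtration) and `f ∈ C²(ℝ × ℝ)`,
then `f(t, Xₜ)` is again an Itô process, with drift
`∂ₜf(t, Xₜ) + bₜ ∂ₓf(t, Xₜ) + ½ σₜ² ∂ₓₓf(t, Xₜ)` and diffusion coefficient `σₜ ∂ₓf(t, Xₜ)`.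
Partial derivatives are Mathlib's one-variable `deriv` / `iteratedDeriv 2` of the sections
`s ↦ f s x` and `f t`; `2⁻¹ = 1 / 2` is the factor written `(1 / 2)` in G15's `ito_formula`,
which is the case `X = B` (`b = 0`, `σ = 1`, `f` independent of `t`).
The adaptedness hypothesis `hXa` is essential (it is not part of `IsItoProcess`, which puts no
measurability on `X₀` or `b`): without it `X` may anticipate (e.g. `Xₜ = B₁ + Bₜ`) and
`σ ∂ₓf(t, Xₜ)` need not admit an Itô integral. With `X` adapted, `∫₀ b ds = X - X₀ - J` is
adapted, `σₜ ∂ₓf(t, Xₜ)` is (essentially) progressive and locally bounded times `σ`, and the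
classical formula applies; the drift needs no adaptedness since `IsItoProcess` only integrates
it pathwise.
**What is wrong (mis-stated; refuted).** As written this `Prop` is *false* in the intended model:
nothing forces `σ` to have Lebesgue-measurable paths (the approximation clause of `IsItoIntegral`
is blind to changes of `σ` on sets of times of inner measure zero), and then the `IntegrableOn`
conjunct of the conclusion can fail; the source's integrands are progressively measurable by
definition (Revuz–Yor, Ch. IV, Def. (2.1), Def. (2.6)). See `ito_formula_itoProcess_of_progressive`
below for the corrected statement (extra hypothesis: `σ` progressively measurable) and the
counterexample, formalised as `not_ito_formula_itoProcess` (`X = B`, `b = 0`, `f(t, x) = x²`,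
`σ = 1 + 𝟙_A(s) 𝟙_{B_{s+1} - B_s > 0}` with `A ⊆ (0, ∞)` of inner measure zero and
non-null-measurable at every scale near `0`).
K. Itô, Mem. Amer. Math. Soc. 4 (1951); Revuz–Yor, *Continuous Martingales and Brownian
Motion* (1999), Ch. IV, Thm (3.3) and Remark 1° after it (the time-dependent form `F(Xₜ, Aₜ)`;
Remark 2° concerns `F` defined on an open set only), Def. (2.1), Def. (2.6).
[cite: RevuzYor1999, Ch. IV Thm (3.3) and Remark 1 — MIS-STATED without the standing hypothesis of Def. (2.1)/(2.6) (progressively measurable integrand); REFUTED in tree by not_ito_formula_itoProcess; corrected as ito_formula_itoProcess_of_progressive (proved: ito_formula_itoProcess_of_progressive_holds)] -/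
@[deprecated "refuted as stated (Literature.Analysis.FunctionSpaces.not_ito_formula_itoProcess, ItoFormulaItoProcessRefutation.lean: the diffusion coefficient σ is not required to be progressively measurable, Revuz–Yor Ch. IV Def. (2.1)/(2.6)); use Literature.Analysis.FunctionSpaces.ito_formula_itoProcess_of_progressive (proved: ito_formula_itoProcess_of_progressive_holds, ItoFormulaProgressive.lean)" (since := "2026-08-15")]
def ito_formula_itoProcess : Prop :=
  ∀ ⦃X b σ : ℝ≥0 → (ℝ≥0 → ℝ) → ℝ⦄ (f : ℝ → ℝ → ℝ), ContDiff ℝ 2 (Function.uncurry f) →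
    Adapted Literature.Probability.RandomPlanarGeometry.brownianFiltration X →
    IsItoProcess X b σ Literature.Probability.Process.brownian Literature.Probability.RandomPlanarGeometry.brownianFiltration Literature.Probability.Process.preWienerMeasure →
    IsItoProcess (fun t ω ↦ f t (X t ω))
      (fun t ω ↦ deriv (fun s ↦ f s (X t ω)) t + b t ω * deriv (f t) (X t ω) +
        2⁻¹ * σ t ω ^ 2 * iteratedDeriv 2 (f t) (X t ω))
      (fun t ω ↦ σ t ω * deriv (f t) (X t ω)) Literature.Probability.Process.brownian Literature.Probability.RandomPlanarGeometry.brownianFiltration Literature.Probability.Process.preWienerMeasure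

/-- **Itô's formula for Itô processes, corrected statement (progressive diffusion
coefficient).** The statement `ito_formula_itoProcess` with the single extra hypothesis
`IsStronglyProgressive brownianFiltration σ`, which is Revuz–Yor's standing assumption on
integrands (`L²(M)` and `L²_loc(M)` consist of *progressively measurable* processes, Ch. IV,
Def. (2.1) and Def. (2.6)): if `X = X₀ + ∫ b ds + ∫ σ dB` is adapted to the raw Brownian
filtration, `σ` is progressively measurable and `f ∈ C²(ℝ × ℝ)`, then `f(t, Xₜ)` is an Itô process
with drift `∂ₜf(t, Xₜ) + bₜ ∂ₓf(t, Xₜ) + ½ σₜ² ∂ₓₓf(t, Xₜ)` and diffusion coefficient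
`σₜ ∂ₓf(t, Xₜ)`. This is Revuz–Yor Ch. IV Thm (3.3) in the form of Remark 1° after it (`F(Xₜ, Aₜ)`
with `Aₜ = t` of finite variation, `F` of class `C²` in `x` and `C¹` in `t`; here `f ∈ C²`
jointly, which is stronger), combined with the associativity `H·(K·M) = (HK)·M` (Prop. (2.4),
Prop. (2.10)(i)) and `⟨σ·B, σ·B⟩ = σ²·⟨B, B⟩ = ∫ σ² ds` (Thm (2.2)) to rewrite `∫ ∂ₓf dX` and
`∫ ∂ₓₓf d⟨X, X⟩` as `∫ ∂ₓf b ds + ∫ ∂ₓf σ dB` and `∫ ∂ₓₓf σ² ds`. Raw (uncompleted) filtration as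
everywhere in this file (label '?': Revuz–Yor work under the usual conditions).
**Discrepancy with `ito_formula_itoProcess`.** There `σ` is constrained only through
`IsItoIntegral σ B J`, whose approximation clause `SimpleProcess.IsApproxSeq` is phrased with `∫⁻`,
Mathlib's *lower* Lebesgue integral (a supremum over measurable simple minorants), which does not
see a modification of `σ` on a set of times of inner Lebesgue measure zero (formalised below as
`SimpleProcess.IsApproxSeq.of_forall_measurableSet_subset_null`). Counterexample to the
uncorrected statement: let `A ⊆ ℝ` have inner measure `0` and meet every non-empty open set in
positive outer measure (a Vitali set translated by the dyadic rationals), let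
`O_ω = {s | B_{s+1}(ω) - B_s(ω) > 0}` and `σₛ(ω) = 1 + 𝟙_A(s) 𝟙_{O_ω}(s)`. The approximating
sequences of `σ` are exactly those of the constant process `1` (a measurable minorant of
`(Hₙ - σ)²` exceeds `(Hₙ - 1)²` only on a measurable subset of `A`, which is null; conversely an
adapted step process cannot select the value `2` on `O_ω`, the increments of `B` after `tᵢ` being
independent of `𝓕_{tᵢ}`), so `IsItoIntegral σ B B`, hence `IsItoProcess B 0 σ B`, holds; with
`f(t, x) = x²` the asserted drift is `σ²  = 1 + 3·𝟙_{A ∩ O_ω}`, which for a.e. `ω` is not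
a.e.-measurable on `[0, t]` for `t` large, so the `IntegrableOn` conjunct of the conclusion
fails. Progressive measurability of `σ` (Borel paths) rules this out, and is what the source
assumes. Named fact (closed `Prop`; proved downstream: `ito_formula_itoProcess_of_progressive_holds`,
`ItoFormulaProgressive.lean`, through the reduction `ito_formula_itoProcess_of_progressive_of_facts`
at the end of this file).
K. Itô, Mem. Amer. Math. Soc. 4 (1951); Revuz–Yor, *Continuous Martingales and Brownian
Motion* (1999), Ch. IV, Thm (3.3) and Remark 1° after it, Prop. (2.4), Prop. (2.10)(i),
Thm (2.2), Def. (2.1), Def. (2.6). [cite: RevuzYor1999, Ch. IV Thm (3.3) and Remark 1] -/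
def ito_formula_itoProcess_of_progressive : Prop :=
  ∀ ⦃X b σ : ℝ≥0 → (ℝ≥0 → ℝ) → ℝ⦄ (f : ℝ → ℝ → ℝ), ContDiff ℝ 2 (Function.uncurry f) →
    Adapted Literature.Probability.RandomPlanarGeometry.brownianFiltration X → IsStronglyProgressive Literature.Probability.RandomPlanarGeometry.brownianFiltration σ →
    IsItoProcess X b σ Literature.Probability.Process.brownian Literature.Probability.RandomPlanarGeometry.brownianFiltration Literature.Probability.Process.preWienerMeasure →
    IsItoProcess (fun t ω ↦ f t (X t ω))
      (fun t ω ↦ deriv (fun s ↦ f s (X t ω)) t + b t ω * deriv (f t) (X t ω) +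
        2⁻¹ * σ t ω ^ 2 * iteratedDeriv 2 (f t) (X t ω))
      (fun t ω ↦ σ t ω * deriv (f t) (X t ω)) Literature.Probability.Process.brownian Literature.Probability.RandomPlanarGeometry.brownianFiltration Literature.Probability.Process.preWienerMeasure

/-- **Itô's formula for Itô processes, integrated form.** For the canonical Brownian motion `B`,
an adapted Itô process `X = X₀ + ∫₀ b ds + ∫₀ σ dB` with progressively measurable `σ`,
`f ∈ C²(ℝ × ℝ)`, and *any* Itô integral `K = ∫₀ σₛ ∂ₓf(s, Xₛ) dBₛ` (in the sense of
`IsItoIntegral`; such `K` exist by `exists_isItoIntegral_mul_of_continuous` and are unique up to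
indistinguishability), almost surely, for all `t`,
`f(t, Xₜ) = f(0, X₀) + ∫₀ᵗ (∂ₜf(s, Xₛ) + bₛ ∂ₓf(s, Xₛ) + ½ σₛ² ∂ₓₓf(s, Xₛ)) ds + Kₜ`.
This is Revuz–Yor Ch. IV Thm (3.3) in the form of Remark 1° after it (`F(Xₜ, Aₜ)`, `Aₜ = t`),
with `∫ ∂ₓf dX = ∫ ∂ₓf b ds + ∫ ∂ₓf σ dB` (associativity, Prop. (2.4), Prop. (2.10)(i)) and
`d⟨X, X⟩ = σ² ds` (Thm (2.2)); the time integral is written exactly as in `IsItoProcess`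
(real time `s` read through `Real.toNNReal`). Raw-filtration version as everywhere in this file
(label '?': the stochastic integrals do not depend on the choice between the raw and the usual
augmentation of the Brownian filtration, Revuz–Yor p. 132). Together with `exists_isItoIntegral`
it yields `ito_formula_itoProcess_of_progressive`
(`ito_formula_itoProcess_of_progressive_of_facts`, proved below). Named fact (closed `Prop`, no
proof here).
K. Itô, Mem. Amer. Math. Soc. 4 (1951); Revuz–Yor, *Continuous Martingales and Brownian
Motion* (1999), Ch. IV, Thm (3.3) and Remark 1° after it, Prop. (2.4), Prop. (2.10)(i),
Thm (2.2). [cite: RevuzYor1999, Ch. IV Thm (3.3) and Remark 1] -/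
def ito_formula_itoProcess_ae : Prop :=
  ∀ ⦃X b σ K : ℝ≥0 → (ℝ≥0 → ℝ) → ℝ⦄ (f : ℝ → ℝ → ℝ), ContDiff ℝ 2 (Function.uncurry f) →
    Adapted Literature.Probability.RandomPlanarGeometry.brownianFiltration X → IsStronglyProgressive Literature.Probability.RandomPlanarGeometry.brownianFiltration σ →
    IsItoProcess X b σ Literature.Probability.Process.brownian Literature.Probability.RandomPlanarGeometry.brownianFiltration Literature.Probability.Process.preWienerMeasure →
    Literature.Probability.Process.IsItoIntegral (fun t ω ↦ σ t ω * deriv (f t) (X t ω)) Literature.Probability.Process.brownian K Literature.Probability.RandomPlanarGeometry.brownianFiltration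
      Literature.Probability.Process.preWienerMeasure →
    ∀ᵐ ω ∂Literature.Probability.Process.preWienerMeasure, ∀ t : ℝ≥0,
      f t (X t ω) = f (0 : ℝ≥0) (X 0 ω) +
        (∫ s in (0 : ℝ)..t, (deriv (fun r ↦ f r (X s.toNNReal ω)) (s.toNNReal : ℝ) +
          b s.toNNReal ω * deriv (f (s.toNNReal : ℝ)) (X s.toNNReal ω) +
          2⁻¹ * σ s.toNNReal ω ^ 2 * iteratedDeriv 2 (f (s.toNNReal : ℝ)) (X s.toNNReal ω))) +
        K t ω

/-! ### Stochastic differential equations: strong solutions -/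

/-- `IsStrongSolution b σ x₀ X B 𝓕 P`: the process `X` is a **solution adapted to `𝓕`** of the
SDE `dXₜ = b(t, Xₜ) dt + σ(t, Xₜ) dBₜ`, `X₀ = x₀`, driven by `B` on `(Ω, 𝓕, P)`: `X` starts at
`x₀`, is `𝓕`-adapted, and is an Itô process with drift `b(t, Xₜ)` and diffusion coefficient
`σ(t, Xₜ)`. For a general filtration `𝓕` this is Revuz–Yor's Def. (1.2); it is a *strong*
solution in their sense (Def. (1.5)) precisely when `𝓕` is the (raw) natural filtration of `B`,
which is the case in every theorem of this file (`brownianFiltration`).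
Revuz–Yor, *Continuous Martingales and Brownian Motion* (1999), Ch. IX, Def. (1.2) and
Def. (1.5) (strong solutions). [folklore] -/
def IsStrongSolution (b σ : ℝ → ℝ → ℝ) (x₀ : ℝ) (X B : ℝ≥0 → Ω → ℝ) (𝓕 : Filtration ℝ≥0 m)
    (P : Measure Ω) : Prop :=
  (∀ ω, X 0 ω = x₀) ∧ Adapted 𝓕 X ∧
    IsItoProcess X (fun s ω ↦ b s (X s ω)) (fun s ω ↦ σ s (X s ω)) B 𝓕 P

section SDE

variable {b σ : ℝ → ℝ → ℝ} {x₀ : ℝ} {X B : ℝ≥0 → Ω → ℝ} {𝓕 : Filtration ℝ≥0 m} {P : Measure Ω}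

/-- A strong solution starts at the prescribed initial value (by definition).
Revuz–Yor, *Continuous Martingales and Brownian Motion* (1999), Ch. IX, Def. (1.2). [folklore] -/
theorem IsStrongSolution.apply_zero (h : IsStrongSolution b σ x₀ X B 𝓕 P) (ω : Ω) :
    X 0 ω = x₀ :=
  h.1 ω

/-- A strong solution is adapted to the driving filtration (by definition).
Revuz–Yor, *Continuous Martingales and Brownian Motion* (1999), Ch. IX, Def. (1.5). [folklore] -/
theorem IsStrongSolution.adapted (h : IsStrongSolution b σ x₀ X B 𝓕 P) : Adapted 𝓕 X :=
  h.2.1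

/-- A strong solution is an Itô process with coefficients evaluated along itself
(by definition).
Revuz–Yor, *Continuous Martingales and Brownian Motion* (1999), Ch. IX, Def. (1.2). [folklore] -/
theorem IsStrongSolution.isItoProcess (h : IsStrongSolution b σ x₀ X B 𝓕 P) :
    IsItoProcess X (fun s ω ↦ b s (X s ω)) (fun s ω ↦ σ s (X s ω)) B 𝓕 P :=
  h.2.2

end SDE

/-- **Itô's existence and pathwise uniqueness theorem** for SDEs with Lipschitz coefficients,
driven by the canonical Brownian motion: if `b, σ : ℝ → ℝ → ℝ` are jointly Borel, Lipschitz in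
the space variable uniformly in time, and locally bounded in time at `x = 0`, then for every
`x₀` the SDE `dX = b(t, X) dt + σ(t, X) dB`, `X₀ = x₀` has a strong solution adapted to the
Brownian filtration, unique up to indistinguishability (the conclusion is `∃ X, … ∧ ∀ X', …`,
not `∃!`, which would be false: solutions are only determined up to null sets).
*Filtration caveat*: adaptedness is
w.r.t. the RAW (uncompleted, not right-continuous) natural filtration `brownianFiltration` of
G15; an a.s.-continuous raw-adapted version of the classical solution is meant (there is no
usual-conditions completion in H21), label '?' for this variant. Named fact (closed `Prop`, no
proof here).
K. Itô, Mem. Amer. Math. Soc. 4 (1951); Revuz–Yor, *Continuous Martingales and Brownian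
Motion* (1999), Ch. IX, Thm (2.1). [cite: RevuzYor1999, Ch. IX Thm (2.1)] -/
def existsUnique_strongSolution_of_lipschitz : Prop :=
  ∀ (b σ : ℝ → ℝ → ℝ) (x₀ : ℝ), Measurable (Function.uncurry b) →
    Measurable (Function.uncurry σ) →
    (∃ K : ℝ≥0, ∀ t, LipschitzWith K (b t) ∧ LipschitzWith K (σ t)) →
    (∀ T : ℝ, ∃ C, ∀ t ∈ Set.Icc 0 T, |b t 0| + |σ t 0| ≤ C) →
    ∃ X : ℝ≥0 → (ℝ≥0 → ℝ) → ℝ,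
      IsStrongSolution b σ x₀ X Literature.Probability.Process.brownian Literature.Probability.RandomPlanarGeometry.brownianFiltration Literature.Probability.Process.preWienerMeasure ∧
      ∀ X', IsStrongSolution b σ x₀ X' Literature.Probability.Process.brownian Literature.Probability.RandomPlanarGeometry.brownianFiltration Literature.Probability.Process.preWienerMeasure →
        ∀ᵐ ω ∂Literature.Probability.Process.preWienerMeasure, ∀ t, X t ω = X' t ω

/-! ### Squared Bessel and Bessel processes -/

/-- `IsSquaredBesselProcess δ z₀ Z B 𝓕 P`: `Z` is a **squared Bessel process of dimension `δ`
started at `z₀`** (`BESQ^δ(z₀)`) driven by `B`, i.e. a strong solution of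
`dZₜ = δ dt + 2 √|Zₜ| dBₜ`, `Z₀ = z₀`.
Revuz–Yor, *Continuous Martingales and Brownian Motion* (1999), Ch. XI, Def. (1.1). [folklore] -/
def IsSquaredBesselProcess (δ z₀ : ℝ) (Z B : ℝ≥0 → Ω → ℝ) (𝓕 : Filtration ℝ≥0 m)
    (P : Measure Ω) : Prop :=
  IsStrongSolution (fun _ _ ↦ δ) (fun _ z ↦ 2 * Real.sqrt |z|) z₀ Z B 𝓕 P

/-- `IsBesselProcess δ x₀ ρ B 𝓕 P`: `ρ` is a **Bessel process of dimension `δ` started at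
`x₀`** (`BES^δ(x₀)`) driven by `B`: the square root `ρ = √Z` of a squared Bessel process
`Z = BESQ^δ(x₀²)` driven by `B` (for `δ ≥ 2`, or `δ > 1` before hitting `0`, equivalently
`dρ = (δ - 1)/(2ρ) dt + dB`).
Revuz–Yor, *Continuous Martingales and Brownian Motion* (1999), Ch. XI, Def. (1.9);
Lawler, *Conformally Invariant Processes in the Plane* (2005), §1.10. [folklore] -/
def IsBesselProcess (δ x₀ : ℝ) (ρ B : ℝ≥0 → Ω → ℝ) (𝓕 : Filtration ℝ≥0 m) (P : Measure Ω) :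
    Prop :=
  ∃ Z, IsSquaredBesselProcess δ (x₀ ^ 2) Z B 𝓕 P ∧ ∀ t ω, ρ t ω = Real.sqrt (Z t ω)

section Bessel

variable {δ x₀ : ℝ} {ρ B : ℝ≥0 → Ω → ℝ} {𝓕 : Filtration ℝ≥0 m} {P : Measure Ω}

/-- A Bessel process has nonnegative paths (it is a square root).
Revuz–Yor, *Continuous Martingales and Brownian Motion* (1999), Ch. XI, Def. (1.9). [folklore] -/
theorem IsBesselProcess.nonneg (h : IsBesselProcess δ x₀ ρ B 𝓕 P) (t : ℝ≥0) (ω : Ω) :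
    0 ≤ ρ t ω := by
  obtain ⟨Z, -, hρ⟩ := h
  rw [hρ]
  exact Real.sqrt_nonneg _

/-- A Bessel process started at `x₀` starts at `|x₀|` (so at `x₀` when `0 ≤ x₀`).
Revuz–Yor, *Continuous Martingales and Brownian Motion* (1999), Ch. XI, Def. (1.9). [folklore] -/
theorem IsBesselProcess.apply_zero (h : IsBesselProcess δ x₀ ρ B 𝓕 P) (ω : Ω) :
    ρ 0 ω = |x₀| := by
  obtain ⟨Z, hZ, hρ⟩ := h
  rw [hρ, IsStrongSolution.apply_zero hZ ω, Real.sqrt_sq_eq_abs]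

/-- **Well-posedness of squared Bessel processes** (driver: the canonical Brownian motion): for
`δ ≥ 0` and `z₀ ≥ 0` the SDE `dZ = δ dt + 2√|Z| dB`, `Z₀ = z₀` has a strong solution, unique up
to indistinguishability (stated as `∃ Z, … ∧ ∀ Z', …`, not `∃!`) — pathwise uniqueness by the Yamada–Watanabe criterion (`z ↦ 2√|z|` is
`½`-Hölder), existence by Yamada–Watanabe's theorem (weak existence + pathwise uniqueness).
Raw-filtration caveat as in `existsUnique_strongSolution_of_lipschitz` ('?'). Named fact
(closed `Prop`, no proof here; dimension and starting point quantified inside).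
Yamada–Watanabe, J. Math. Kyoto Univ. 11 (1971); Revuz–Yor, *Continuous Martingales and
Brownian Motion* (1999), Ch. IX, Thm (1.7), Thm (3.5), and Ch. XI, §1 (before Def. (1.1)). [cite: RevuzYor1999, Ch. XI §1 Def. (1.1) and Ch. IX Thm (3.5)] -/
def existsUnique_squaredBessel : Prop :=
  ∀ ⦃δ z₀ : ℝ⦄, 0 ≤ δ → 0 ≤ z₀ →
    ∃ Z : ℝ≥0 → (ℝ≥0 → ℝ) → ℝ,
      IsSquaredBesselProcess δ z₀ Z Literature.Probability.Process.brownian Literature.Probability.RandomPlanarGeometry.brownianFiltration Literature.Probability.Process.preWienerMeasure ∧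
      ∀ Z', IsSquaredBesselProcess δ z₀ Z' Literature.Probability.Process.brownian Literature.Probability.RandomPlanarGeometry.brownianFiltration Literature.Probability.Process.preWienerMeasure →
        ∀ᵐ ω ∂Literature.Probability.Process.preWienerMeasure, ∀ t, Z t ω = Z' t ω

/-- A squared Bessel process of dimension `δ ≥ 0` started at `z₀ ≥ 0` stays nonnegative
(comparison theorem), when the driver `B` is an `𝓕`-Brownian motion in Lévy's form. Named fact
(no proof here), `𝓕`, `P` explicit and the processes and parameters quantified inside.
Revuz–Yor, *Continuous Martingales and Brownian Motion* (1999), Ch. XI, §1 (before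
Def. (1.1)) and Ch. IX, Thm (3.7). [cite: RevuzYor1999, Ch. IX Thm (3.7) and Ch. XI §1] -/
def IsSquaredBesselProcess.ae_forall_nonneg (𝓕 : Filtration ℝ≥0 m) (P : Measure Ω) : Prop :=
  ∀ ⦃δ z₀ : ℝ⦄ ⦃Z B : ℝ≥0 → Ω → ℝ⦄ [IsProbabilityMeasure P],
    IsSquaredBesselProcess δ z₀ Z B 𝓕 P → Literature.Probability.RandomPlanarGeometry.IsLocalMartingale B 𝓕 P → (∀ ω, B 0 ω = 0) →
    (∀ᵐ ω ∂P, Continuous (B · ω)) →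
    Literature.Probability.Process.HasQuadraticVariation B (fun (t : ℝ≥0) (_ : Ω) ↦ (t : ℝ)) 𝓕 P → 0 ≤ δ → 0 ≤ z₀ →
    ∀ᵐ ω ∂P, ∀ t, 0 ≤ Z t ω

/-- **Bessel processes of dimension `δ ≥ 2` never hit `0`**: if `ρ` is a `BES^δ(x₀)` with
`δ ≥ 2`, `x₀ > 0`, driven by an `𝓕`-Brownian motion `B` (Lévy form: continuous local
martingale, `B₀ = 0`, `⟨B⟩ₜ = t`), then a.s. `ρₜ > 0` for all `t`. Named fact (no proof here),
`𝓕`, `P` explicit and the processes and parameters quantified inside.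
Revuz–Yor, *Continuous Martingales and Brownian Motion* (1999), Ch. XI, §1, remarks after
(1.5) and Prop. (1.5); Lawler (2005), Prop. 1.21. [cite: Lawler2005] -/
def IsBesselProcess.ae_forall_pos (𝓕 : Filtration ℝ≥0 m) (P : Measure Ω) : Prop :=
  ∀ ⦃δ x₀ : ℝ⦄ ⦃ρ B : ℝ≥0 → Ω → ℝ⦄ [IsProbabilityMeasure P],
    IsBesselProcess δ x₀ ρ B 𝓕 P → Literature.Probability.RandomPlanarGeometry.IsLocalMartingale B 𝓕 P → (∀ ω, B 0 ω = 0) →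
    (∀ᵐ ω ∂P, Continuous (B · ω)) →
    Literature.Probability.Process.HasQuadraticVariation B (fun (t : ℝ≥0) (_ : Ω) ↦ (t : ℝ)) 𝓕 P → 2 ≤ δ → 0 < x₀ →
    ∀ᵐ ω ∂P, ∀ t, 0 < ρ t ω

/-- **Bessel processes of dimension `δ < 2` hit `0`**: if `ρ` is a `BES^δ(x₀)` with `δ < 2`
driven by an `𝓕`-Brownian motion `B` (Lévy form), then a.s. `ρₜ = 0` for some `t`. Named fact
(no proof here), `𝓕`, `P` explicit and the processes and parameters quantified inside.
Revuz–Yor, *Continuous Martingales and Brownian Motion* (1999), Ch. XI, §1, remarks after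
(1.5); Lawler (2005), Prop. 1.21. [cite: Lawler2005] -/
def IsBesselProcess.ae_exists_eq_zero (𝓕 : Filtration ℝ≥0 m) (P : Measure Ω) : Prop :=
  ∀ ⦃δ x₀ : ℝ⦄ ⦃ρ B : ℝ≥0 → Ω → ℝ⦄ [IsProbabilityMeasure P],
    IsBesselProcess δ x₀ ρ B 𝓕 P → Literature.Probability.RandomPlanarGeometry.IsLocalMartingale B 𝓕 P → (∀ ω, B 0 ω = 0) →
    (∀ᵐ ω ∂P, Continuous (B · ω)) →
    Literature.Probability.Process.HasQuadraticVariation B (fun (t : ℝ≥0) (_ : Ω) ↦ (t : ℝ)) 𝓕 P → δ < 2 →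
    ∀ᵐ ω ∂P, ∃ t, ρ t ω = 0

end Bessel

/-! ### The SLE–Bessel bridge and swallowing of real points -/

section SLE

/-- **SLE_κ and Bessel processes**: for chordal SLE_κ with driving function `Wₜ = √κ Bₜ`
(`sleDriving κ`) and a real point `x > 0`, the rescaled process `(gₜ(x) - Wₜ)/√κ` coincides, up
to the swallowing time `T_x` of `x`, with a Bessel process of dimension `1 + 4/κ` started at
`x/√κ` and driven by `-B` (indeed `d(gₜ(x) - Wₜ) = 2/(gₜ(x) - Wₜ) dt - √κ dBₜ`). The Bessel
process lives on the canonical space with the raw Brownian filtration. Named fact (closed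
`Prop`, no proof here; `κ` and `x` quantified inside).
Rohde–Schramm, *Basic properties of SLE*, Ann. of Math. 161 (2005), §6, remark after Lemma 6.2
("Set `Y_x(t) := g_t(x) - ξ(t)`. Then `Y_x(t)/√κ` is a Bessel process of dimension `1 + 4/κ`")
and the equation `dY_x = (2/Y_x) dt + dξ` in the proof of Lemma 6.2; Lawler, *Conformally
Invariant Processes in the Plane* (2005), §6.2 ('?'). [cite: RohdeSchramm2005, §6 remark after Lemma 6.2] -/
def sle_bessel : Prop :=
  ∀ ⦃κ : ℝ≥0⦄ ⦃x : ℝ⦄, 0 < κ → 0 < x →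
    ∃ ρ : ℝ≥0 → (ℝ≥0 → ℝ) → ℝ,
      IsBesselProcess (1 + 4 / (κ : ℝ)) (x / Real.sqrt κ) ρ (fun t ω ↦ -Literature.Probability.Process.brownian t ω)
        Literature.Probability.RandomPlanarGeometry.brownianFiltration Literature.Probability.Process.preWienerMeasure ∧
      ∀ᵐ ω ∂Literature.Probability.Process.preWienerMeasure, ∀ t : ℝ≥0,
        (t : WithTop ℝ≥0) < Literature.Probability.RandomPlanarGeometry.Loewner.swallowingTime (Literature.Probability.RandomPlanarGeometry.sleDriving κ ω) x →
          ρ t ω = ((Literature.Probability.RandomPlanarGeometry.Loewner.map (Literature.Probability.RandomPlanarGeometry.sleDriving κ ω) t x).re - Literature.Probability.RandomPlanarGeometry.sleDriving κ ω t) / Real.sqrt κ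

/-- **SLE phases on the real line**: for `κ > 0` and a real point `x > 0`, the point `x` is
swallowed by the SLE_κ hulls in finite time almost surely if and only if `κ > 4` (the Bessel
dimension `1 + 4/κ` is `< 2` iff `κ > 4`; for `κ ≤ 4` the swallowing time is a.s. infinite).
Named fact (closed `Prop`, no proof here; `κ` and `x` quantified inside).
Rohde–Schramm, *Basic properties of SLE*, Ann. of Math. 161 (2005), §6: Lemma 6.5 ("Let
`z ∈ H̄ ∖ {0}`. If `κ > 4`, then `P[τ(z) < ∞] = 1`") for `⇐`, and the proof of Lemma 6.2 ("a.s.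
for every `x > 0` we have `Y_x(t)` well defined and in `(0, ∞)` for all `t ≥ 0`", `κ ≤ 4`) for
`⇒`; Lawler, *Conformally Invariant Processes in the Plane* (2005), §6.2 ('?'). [cite: RohdeSchramm2005, §6 Lemma 6.5 and proof of Lemma 6.2] -/
def sle_swallows_real_iff : Prop :=
  ∀ ⦃κ : ℝ≥0⦄ ⦃x : ℝ⦄, 0 < κ → 0 < x →
    ((∀ᵐ ω ∂Literature.Probability.Process.preWienerMeasure, Literature.Probability.RandomPlanarGeometry.Loewner.swallowingTime (Literature.Probability.RandomPlanarGeometry.sleDriving κ ω) x < ⊤) ↔ 4 < κ)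

end SLE

/-! ### Proof layer: reduction of Itô's formula for Itô processes

The corrected fact `ito_formula_itoProcess_of_progressive` is reduced
(`ito_formula_itoProcess_of_progressive_of_facts`) to the two named facts `exists_isItoIntegral`
(`Literature.Probability.Process.ItoCalculus`) and `ito_formula_itoProcess_ae`; everything in
between — boundedness of simple processes, Borel paths of progressive processes, pathwise
`σ ∈ L²_loc` from the approximating sequence, a.s. continuity of Itô processes, the calculus of the
partial derivatives in `deriv` form, local integrability of the drift, and a progressively
measurable version (dyadic regularisation) of an adapted continuous integrand — is proved. It
opens with the formal core of the counterexample to `ito_formula_itoProcess`: the approximation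
mode `SimpleProcess.IsApproxSeq` cannot see a modification of the integrand on a set of times of
inner measure zero (`SimpleProcess.IsApproxSeq.of_forall_measurableSet_subset_null`). -/

/-! #### The mechanism of the mis-statement: `∫⁻` is blind to inner-null modifications -/

/-- **Lower integrals are blind to inner-null modifications.** If `g` is measurable and `g'`
differs from `g` only on a set all of whose measurable subsets are null (a set of inner measure
zero, not necessarily measurable), then `∫⁻ g' ≤ ∫⁻ g`: Mathlib's `∫⁻` is the *lower* integral, a
supremum over measurable simple minorants, and a measurable minorant of `g'` exceeds `g` only on
a measurable subset of the exceptional set. [folklore] -/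
theorem lintegral_le_of_forall_measurableSet_subset_null {α : Type*} {mα : MeasurableSpace α}
    {μ : Measure α} {g g' : α → ℝ≥0∞} (hg : Measurable g)
    (hD : ∀ M : Set α, MeasurableSet M → M ⊆ {a | g a ≠ g' a} → μ M = 0) :
    ∫⁻ a, g' a ∂μ ≤ ∫⁻ a, g a ∂μ := by
  rw [MeasureTheory.lintegral]
  refine iSup₂_le fun φ hφ ↦ ?_
  rw [← SimpleFunc.lintegral_eq_lintegral]
  refine lintegral_mono_ae ?_
  have hS : μ {a | g a < φ a} = 0 := by
    refine hD _ (measurableSet_lt hg φ.measurable) fun a ha ↦ ?_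
    exact fun heq ↦ (lt_irrefl _ ((ha.trans_le (hφ a)).trans_eq heq.symm))
  rw [ae_iff]
  simpa only [not_le] using hS

section SimpleProcess
open Literature.Probability.Process (SimpleProcess)
open Literature.Probability.Process.SimpleProcess

variable {𝓕 : Filtration ℝ≥0 m} {P : Measure Ω}

/-- The step process of a simple process has Borel paths (in real time through `Real.toNNReal`).
Revuz–Yor, *Continuous Martingales and Brownian Motion* (1999), Ch. IV, Def. (2.3). [folklore] -/
theorem _root_.Literature.Probability.Process.SimpleProcess.measurable_toProcess_path (H : SimpleProcess m 𝓕) (ω : Ω) :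
    Measurable fun s : ℝ ↦ H.toProcess s.toNNReal ω := by
  have : Measurable fun t : ℝ≥0 ↦ H.toProcess t ω := by
    unfold toProcess
    refine Finset.measurable_sum _ fun i _ ↦ ?_
    exact (measurable_const.indicator measurableSet_Ioc)
  exact this.comp measurable_real_toNNReal

/-- **The approximation mode `IsApproxSeq` is blind to inner-null modifications of the
integrand.** If `H` has Borel paths and, for every `ω`, `H' · ω` differs from `H · ω` only on a
set of times all of whose measurable subsets are Lebesgue-null (e.g. the trace of a set of inner
measure zero), then every approximating sequence of `H` is an approximating sequence of `H'`,
although `H'` need not have measurable paths. This is the mechanism behind the mis-statement of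
`ito_formula_itoProcess` (see `ito_formula_itoProcess_of_progressive`). [folklore] -/
theorem _root_.Literature.Probability.Process.SimpleProcess.IsApproxSeq.of_forall_measurableSet_subset_null {Hn : ℕ → SimpleProcess m 𝓕}
    {H H' : ℝ≥0 → Ω → ℝ} (h : IsApproxSeq Hn H P)
    (hH : ∀ ω, Measurable fun s : ℝ ↦ H s.toNNReal ω)
    (hD : ∀ ω, ∀ M : Set ℝ, MeasurableSet M →
      M ⊆ {s | H s.toNNReal ω ≠ H' s.toNNReal ω} → volume M = 0) :
    IsApproxSeq Hn H' P := by
  intro t ε hε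
  have hle : ∀ n ω,
      ∫⁻ s in Set.Icc (0 : ℝ) t,
          ENNReal.ofReal (((Hn n).toProcess s.toNNReal ω - H' s.toNNReal ω) ^ 2) ≤
        ∫⁻ s in Set.Icc (0 : ℝ) t,
          ENNReal.ofReal (((Hn n).toProcess s.toNNReal ω - H s.toNNReal ω) ^ 2) := by
    intro n ω
    refine lintegral_le_of_forall_measurableSet_subset_null
      ((((Hn n).measurable_toProcess_path ω).sub (hH ω)).pow_const 2).ennreal_ofReal
      fun M hM hsub ↦ ?_
    rw [Measure.restrict_apply hM]
    refine measure_mono_null Set.inter_subset_left (hD ω M hM fun s hs ↦ ?_)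
    have hne := hsub hs
    simp only [ne_eq, Set.mem_setOf_eq] at hne ⊢
    intro heq
    exact hne (by rw [heq])
  refine tendsto_of_tendsto_of_tendsto_of_le_of_le tendsto_const_nhds (h t ε hε)
    (fun n ↦ bot_le) fun n ↦ measure_mono fun ω hω ↦ ?_
  exact le_trans hω (hle n ω)

end SimpleProcess

/-! #### A progressively measurable version of an adapted process with continuous paths -/

/-- Dyadic lower approximation of a time: `dyadicFloor n t = ⌊2ⁿ t⌋ / 2ⁿ ≤ t`. [folklore] -/
def dyadicFloor (n : ℕ) (t : ℝ≥0) : ℝ≥0 :=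
  ((⌊(t : ℝ) * 2 ^ n⌋₊ : ℕ) : ℝ≥0) / 2 ^ n

/-- The dyadic lower approximation is below the time it approximates. [folklore] -/
theorem dyadicFloor_le (n : ℕ) (t : ℝ≥0) : dyadicFloor n t ≤ t := by
  rw [dyadicFloor, div_le_iff₀ (pow_pos two_pos n), ← NNReal.coe_le_coe]
  push_cast
  exact Nat.floor_le (by positivity)

/-- The dyadic lower approximation, read in `ℝ`. [folklore] -/
theorem coe_dyadicFloor (n : ℕ) (t : ℝ≥0) :
    (dyadicFloor n t : ℝ) = (⌊(t : ℝ) * 2 ^ n⌋₊ : ℕ) / 2 ^ n := by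
  rw [dyadicFloor]; push_cast; rfl

/-- The dyadic lower approximation of level `n` is within `2⁻ⁿ` of the time. [folklore] -/
theorem sub_lt_dyadicFloor (n : ℕ) (t : ℝ≥0) : (t : ℝ) - 1 / 2 ^ n < dyadicFloor n t := by
  rw [coe_dyadicFloor, lt_div_iff₀ (pow_pos two_pos n), sub_mul,
    div_mul_cancel₀ _ (pow_ne_zero n two_ne_zero)]
  exact Nat.sub_one_lt_floor _

/-- The dyadic lower approximations converge to the time. [folklore] -/
theorem tendsto_dyadicFloor (t : ℝ≥0) : Tendsto (fun n ↦ dyadicFloor n t) atTop (𝓝 t) := by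
  rw [← NNReal.tendsto_coe]
  have h0 : Tendsto (fun n : ℕ ↦ (t : ℝ) - 1 / 2 ^ n) atTop (𝓝 (t : ℝ)) := by
    have : Tendsto (fun n : ℕ ↦ (1 / 2 : ℝ) ^ n) atTop (𝓝 0) :=
      tendsto_pow_atTop_nhds_zero_of_lt_one (by norm_num) (by norm_num)
    simpa using (tendsto_const_nhds (x := (t : ℝ))).sub this
  refine tendsto_of_tendsto_of_tendsto_of_le_of_le h0 tendsto_const_nhds
    (fun n ↦ (sub_lt_dyadicFloor n t).le) fun n ↦ ?_
  exact_mod_cast dyadicFloor_le n t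

/-- The dyadic lower approximation is a measurable function of time. [folklore] -/
theorem measurable_dyadicFloor (n : ℕ) : Measurable (dyadicFloor n) := by
  unfold dyadicFloor
  refine Measurable.div_const ?_ _
  exact (measurable_from_nat (f := fun k : ℕ ↦ (k : ℝ≥0))).comp
    ((measurable_coe_nnreal_real.mul_const _).nat_floor)

/-- The **dyadic regularisation** of a process `g : ℝ≥0 → Ω → ℝ`: at time `t` the limit (if any;
junk value otherwise, from `limUnder`) of `g` along the dyadic lower approximations
`⌊2ⁿ t⌋ / 2ⁿ ↑ t`. It agrees with `g` on every (left-)continuous path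
(`dyadicReg_apply_of_continuous`) and is progressively measurable as soon as `g` is adapted
(`isStronglyProgressive_dyadicReg`):
the standard device producing a progressive version of an adapted continuous process.
Karatzas–Shreve, *Brownian Motion and Stochastic Calculus* (1991), Prop. 1.1.13; Revuz–Yor,
*Continuous Martingales and Brownian Motion* (1999), Ch. I, Prop. (4.8). [folklore] -/
def dyadicReg (g : ℝ≥0 → Ω → ℝ) : ℝ≥0 → Ω → ℝ :=
  fun t ω ↦ limUnder atTop fun n : ℕ ↦ g (dyadicFloor n t) ω

/-- The dyadic regularisation agrees with the process on every continuous path.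
Karatzas–Shreve, *Brownian Motion and Stochastic Calculus* (1991), Prop. 1.1.13. [folklore] -/
theorem dyadicReg_apply_of_continuous {g : ℝ≥0 → Ω → ℝ} {ω : Ω} (h : Continuous (g · ω))
    (t : ℝ≥0) : dyadicReg g t ω = g t ω :=
  ((h.tendsto t).comp (tendsto_dyadicFloor t)).limUnder_eq

/-- The dyadic regularisation of an adapted real process is (strongly) progressively
measurable. [folklore] -/
theorem isStronglyProgressive_dyadicReg {𝓕 : Filtration ℝ≥0 m} {g : ℝ≥0 → Ω → ℝ}
    (hg : Adapted 𝓕 g) : IsStronglyProgressive 𝓕 (dyadicReg g) := by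
  intro i
  -- each dyadic approximation factors through `ℕ × Ω`
  have hn : ∀ n : ℕ, Measurable[MeasurableSpace.prod Subtype.instMeasurableSpace (𝓕 i)]
      fun p : Set.Iic i × Ω ↦ g (dyadicFloor n p.1) p.2 := by
    intro n
    let Ψ : ℕ × Ω → ℝ := fun q ↦ g (min ((q.1 : ℝ≥0) / 2 ^ n) i) q.2
    have hΨ : Measurable[MeasurableSpace.prod Nat.instMeasurableSpace (𝓕 i)] Ψ := by
      refine @measurable_from_prod_countable_right ℕ Ω ℝ _ (𝓕 i) _ _ _ Ψ fun k ↦ ?_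
      exact (hg (min ((k : ℝ≥0) / 2 ^ n) i)).mono (𝓕.mono (min_le_right _ _)) le_rfl
    let Φ : Set.Iic i × Ω → ℕ × Ω := fun p ↦ (⌊((p.1 : ℝ≥0) : ℝ) * 2 ^ n⌋₊, p.2)
    have hΦ1 : Measurable[MeasurableSpace.prod Subtype.instMeasurableSpace (𝓕 i)]
        fun p : Set.Iic i × Ω ↦ ⌊((p.1 : ℝ≥0) : ℝ) * 2 ^ n⌋₊ :=
      ((measurable_coe_nnreal_real.comp measurable_subtype_coe).mul_const _).nat_floor.comp
        (@measurable_fst _ _ _ (𝓕 i))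
    have hΦ2 : @Measurable (Set.Iic i × Ω) Ω
        (MeasurableSpace.prod Subtype.instMeasurableSpace (𝓕 i)) (𝓕 i) fun p ↦ p.2 :=
      @measurable_snd _ _ _ (𝓕 i)
    have hΦ : @Measurable (Set.Iic i × Ω) (ℕ × Ω)
        (MeasurableSpace.prod Subtype.instMeasurableSpace (𝓕 i))
        (MeasurableSpace.prod Nat.instMeasurableSpace (𝓕 i)) Φ := hΦ1.prodMk hΦ2
    have heq : (fun p : Set.Iic i × Ω ↦ g (dyadicFloor n p.1) p.2) = Ψ ∘ Φ := by
      funext p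
      simp only [Function.comp_apply, Ψ, Φ, dyadicFloor]
      rw [min_eq_left]
      exact (dyadicFloor_le n p.1).trans p.1.2
    rw [heq]
    exact hΨ.comp hΦ
  exact @StronglyMeasurable.limUnder ℕ (Set.Iic i × Ω) ℝ
    (MeasurableSpace.prod Subtype.instMeasurableSpace (𝓕 i)) _ _ atTop _
    (fun n p ↦ g (dyadicFloor n p.1) p.2) _ _ fun n ↦ (hn n).stronglyMeasurable

/-! #### Simple processes are bounded -/

section SimpleProcess
open Literature.Probability.Process (SimpleProcess)
open Literature.Probability.Process.SimpleProcess

variable {𝓕 : Filtration ℝ≥0 m}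

/-- The step process of a (bounded) simple process is bounded, uniformly in `(t, ω)` (crude
bound: number of steps times the bound on the values).
Revuz–Yor, *Continuous Martingales and Brownian Motion* (1999), Ch. IV, Def. (2.3). [folklore] -/
theorem _root_.Literature.Probability.Process.SimpleProcess.exists_abs_toProcess_le (H : SimpleProcess m 𝓕) :
    ∃ C : ℝ, ∀ t ω, |H.toProcess t ω| ≤ C := by
  obtain ⟨C, hC⟩ := H.bounded
  refine ⟨(H.times.length - 1 : ℕ) * |C|, fun t ω ↦ ?_⟩
  unfold toProcess
  refine (Finset.abs_sum_le_sum_abs _ _).trans ?_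
  refine (Finset.sum_le_card_nsmul _ _ |C| fun i _ ↦ ?_).trans ?_
  · have h := norm_indicator_le_norm_self (s := Set.Ioc (H.time i) (H.time (i + 1)))
      (f := fun _ ↦ H.value i ω) (a := t)
    simp only [Real.norm_eq_abs] at h
    exact h.trans ((hC i ω).trans (le_abs_self C))
  · simp

end SimpleProcess

/-! #### Sections of progressive processes -/

/-- The paths of a (strongly) progressively measurable real process, read on `ℝ` through
`Real.toNNReal`, are Borel measurable (sections of jointly measurable maps, exhausting `ℝ≥0` by
the intervals `[0, n]`).
Revuz–Yor, *Continuous Martingales and Brownian Motion* (1999), Ch. I, Def. (4.7). [folklore] -/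
theorem measurable_path_of_isStronglyProgressive {𝓕 : Filtration ℝ≥0 m} {σ : ℝ≥0 → Ω → ℝ}
    (hσ : IsStronglyProgressive 𝓕 σ) (ω : Ω) : Measurable fun s : ℝ ↦ σ s.toNNReal ω := by
  -- measurability on `ℝ≥0`, by exhaustion along `Iic n`
  have hsec : ∀ n : ℕ, Measurable fun s : ℝ≥0 ↦ σ (min s n) ω := by
    intro n
    have h1 : StronglyMeasurable[Subtype.instMeasurableSpace.prod (𝓕 n)]
        (fun p : Set.Iic (n : ℝ≥0) × Ω ↦ σ p.1 p.2) := hσ n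
    have h2 : @Measurable (Set.Iic (n : ℝ≥0)) (Set.Iic (n : ℝ≥0) × Ω) _
        (Subtype.instMeasurableSpace.prod (𝓕 n)) (fun s ↦ (s, ω)) :=
      @measurable_prodMk_right _ _ _ (𝓕 n) ω
    have h3 : StronglyMeasurable (fun s : Set.Iic (n : ℝ≥0) ↦ σ s ω) := h1.comp_measurable h2
    have h4 : Measurable fun s : ℝ≥0 ↦
        (⟨min s n, Set.mem_Iic.2 (min_le_right _ _)⟩ : Set.Iic (n : ℝ≥0)) :=
      (measurable_id.min measurable_const).subtype_mk
    exact h3.measurable.comp h4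
  have hlim : ∀ s : ℝ≥0, Tendsto (fun n : ℕ ↦ σ (min s n) ω) atTop (𝓝 (σ s ω)) := by
    intro s
    refine tendsto_const_nhds.congr' ?_
    obtain ⟨N, hN⟩ := exists_nat_ge s
    filter_upwards [Filter.eventually_ge_atTop N] with n hn
    rw [min_eq_left (hN.trans (Nat.cast_le.2 hn))]
  have : Measurable fun s : ℝ≥0 ↦ σ s ω := measurable_of_tendsto_metrizable hsec
    (tendsto_pi_nhds.2 hlim)
  exact this.comp measurable_real_toNNReal

/-! #### Square integrability of an Itô integrand with measurable paths -/

/-- If `σ` admits an approximating sequence of simple processes in the sense of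
`SimpleProcess.IsApproxSeq`, then almost surely the (lower) integral `∫⁻₀ᵗ σ² ds` is finite for
every `t` (no measurability of `σ` is needed: `∫⁻` is monotone and additive against constants;
bound `σ² ≤ 2 (Hₙ - σ)² + 2 C²` with `C` a bound of the simple process `Hₙ`).
Revuz–Yor, *Continuous Martingales and Brownian Motion* (1999), Ch. IV, Def. (2.6). [folklore] -/
theorem ae_lintegral_sq_lt_top_of_isApproxSeq {𝓕 : Filtration ℝ≥0 m} {P : Measure Ω}
    {σ : ℝ≥0 → Ω → ℝ} {Hn : ℕ → Literature.Probability.Process.SimpleProcess m 𝓕} (happ : Literature.Probability.Process.SimpleProcess.IsApproxSeq Hn σ P) :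
    ∀ᵐ ω ∂P, ∀ t : ℝ≥0,
      ∫⁻ s in Set.Icc (0 : ℝ) t, ENNReal.ofReal (σ s.toNNReal ω ^ 2) < ∞ := by
  -- it suffices to treat `t = N : ℕ`
  suffices h : ∀ N : ℕ, ∀ᵐ ω ∂P,
      ∫⁻ s in Set.Icc (0 : ℝ) N, ENNReal.ofReal (σ s.toNNReal ω ^ 2) < ∞ by
    filter_upwards [ae_all_iff.2 h] with ω hω t
    obtain ⟨N, hN⟩ := exists_nat_ge t
    refine lt_of_le_of_lt (lintegral_mono_set (Set.Icc_subset_Icc_right ?_)) (hω N)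
    exact_mod_cast hN
  intro N
  have hlim := happ N 1 one_pos
  -- the exceptional set is contained in every deviation event
  rw [ae_iff]
  refine le_antisymm (ge_of_tendsto hlim (Eventually.of_forall fun n ↦ measure_mono ?_)) bot_le
  intro ω hω
  simp only [not_lt, top_le_iff, Set.mem_setOf_eq] at hω
  simp only [Set.mem_setOf_eq]
  by_contra hcon
  push Not at hcon
  obtain ⟨C, hC⟩ := (Hn n).exists_abs_toProcess_le
  -- pointwise bound `σ² ≤ 2 (Hₙ - σ)² + 2 C²`
  have hpt : ∀ s : ℝ, ENNReal.ofReal (σ s.toNNReal ω ^ 2) ≤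
      2 * ENNReal.ofReal (((Hn n).toProcess s.toNNReal ω - σ s.toNNReal ω) ^ 2) +
        ENNReal.ofReal (2 * C ^ 2) := by
    intro s
    have hb := hC s.toNNReal ω
    have h1 : σ s.toNNReal ω ^ 2 ≤
        2 * ((Hn n).toProcess s.toNNReal ω - σ s.toNNReal ω) ^ 2 + 2 * C ^ 2 := by
      have habs : (Hn n).toProcess s.toNNReal ω ^ 2 ≤ C ^ 2 := by
        rw [← sq_abs, ← sq_abs C]
        exact pow_le_pow_left₀ (abs_nonneg _) (hb.trans (le_abs_self C)) 2
      nlinarith [sq_nonneg ((Hn n).toProcess s.toNNReal ω - σ s.toNNReal ω +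
        (Hn n).toProcess s.toNNReal ω),
        sq_nonneg ((Hn n).toProcess s.toNNReal ω)]
    calc ENNReal.ofReal (σ s.toNNReal ω ^ 2)
        ≤ ENNReal.ofReal (2 * ((Hn n).toProcess s.toNNReal ω - σ s.toNNReal ω) ^ 2 +
            2 * C ^ 2) := ENNReal.ofReal_le_ofReal h1
      _ = _ := by
        rw [ENNReal.ofReal_add (by positivity) (by positivity), ENNReal.ofReal_mul zero_le_two,
          ENNReal.ofReal_ofNat]
  have hfin : ∫⁻ s in Set.Icc (0 : ℝ) N, ENNReal.ofReal (σ s.toNNReal ω ^ 2) < ∞ := by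
    calc ∫⁻ s in Set.Icc (0 : ℝ) N, ENNReal.ofReal (σ s.toNNReal ω ^ 2)
        ≤ ∫⁻ s in Set.Icc (0 : ℝ) N,
            2 * ENNReal.ofReal (((Hn n).toProcess s.toNNReal ω - σ s.toNNReal ω) ^ 2) +
              ENNReal.ofReal (2 * C ^ 2) := lintegral_mono hpt
      _ = (2 * ∫⁻ s in Set.Icc (0 : ℝ) N,
            ENNReal.ofReal (((Hn n).toProcess s.toNNReal ω - σ s.toNNReal ω) ^ 2)) +
            ENNReal.ofReal (2 * C ^ 2) * volume (Set.Icc (0 : ℝ) N) := by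
        rw [lintegral_add_right _ measurable_const, lintegral_const_mul' _ _ ENNReal.ofNat_ne_top,
          lintegral_const, Measure.restrict_apply_univ]
      _ < ∞ := by
        refine ENNReal.add_lt_top.2 ⟨ENNReal.mul_lt_top ENNReal.ofNat_lt_top ?_, ?_⟩
        · exact hcon.trans ENNReal.ofReal_lt_top
        · rw [Real.volume_Icc]
          exact ENNReal.mul_lt_top ENNReal.ofReal_lt_top ENNReal.ofReal_lt_top
  exact hfin.ne hω

/-- If `σ` has Borel paths and admits an approximating sequence of simple processes, then
almost surely `σ²` is integrable on every `[0, t]` (`σ ∈ L²_loc` pathwise).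
Revuz–Yor, *Continuous Martingales and Brownian Motion* (1999), Ch. IV, Def. (2.6). [folklore] -/
theorem ae_integrableOn_sq_of_isApproxSeq {𝓕 : Filtration ℝ≥0 m} {P : Measure Ω}
    {σ : ℝ≥0 → Ω → ℝ} {Hn : ℕ → Literature.Probability.Process.SimpleProcess m 𝓕} (happ : Literature.Probability.Process.SimpleProcess.IsApproxSeq Hn σ P)
    (hσm : ∀ ω, Measurable fun s : ℝ ↦ σ s.toNNReal ω) :
    ∀ᵐ ω ∂P, ∀ t : ℝ≥0, IntegrableOn (fun s : ℝ ↦ σ s.toNNReal ω ^ 2) (Set.Icc 0 t) := by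
  filter_upwards [ae_lintegral_sq_lt_top_of_isApproxSeq happ] with ω hω t
  refine ⟨((hσm ω).pow_const 2).aestronglyMeasurable, ?_⟩
  rw [hasFiniteIntegral_iff_ofReal (ae_of_all _ fun s ↦ sq_nonneg _)]
  exact hω t

/-! #### Paths of an Itô process -/

section ItoProcessPaths

variable {X b σ B : ℝ≥0 → Ω → ℝ} {𝓕 : Filtration ℝ≥0 m} {P : Measure Ω}

/-- A drift which is integrable on every `[0, t]` (read on `ℝ` through `Real.toNNReal`, hence
constant on `(-∞, 0]`) is interval integrable between any two real times. [folklore] -/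
theorem intervalIntegrable_of_forall_integrableOn_Icc {g : ℝ → ℝ} (hg0 : ∀ s ≤ 0, g s = g 0)
    (hg : ∀ t : ℝ≥0, IntegrableOn g (Set.Icc 0 t)) (a c : ℝ) :
    IntervalIntegrable g volume a c := by
  obtain ⟨M, hM⟩ := exists_nat_ge (max |a| |c|)
  have ha : a ∈ Set.Icc (-(M : ℝ)) M := by
    constructor <;> linarith [abs_le.1 ((le_max_left _ _).trans hM) |>.1,
      abs_le.1 ((le_max_left _ _).trans hM) |>.2]
  have hc : c ∈ Set.Icc (-(M : ℝ)) M := by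
    constructor <;> linarith [abs_le.1 ((le_max_right _ _).trans hM) |>.1,
      abs_le.1 ((le_max_right _ _).trans hM) |>.2]
  refine (IntegrableOn.mono_set ?_ (Set.uIcc_subset_Icc ha hc)).intervalIntegrable
  rw [← Set.Icc_union_Icc_eq_Icc (by simp : (-(M : ℝ)) ≤ 0) (by simp : (0 : ℝ) ≤ M)]
  refine IntegrableOn.union ?_ (by simpa using hg M)
  have hconst : IntegrableOn (fun _ : ℝ ↦ g 0) (Set.Icc (-(M : ℝ)) 0) volume :=
    integrableOn_const (by rw [Real.volume_Icc]; exact ENNReal.ofReal_ne_top)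
  exact hconst.congr_fun (fun s hs ↦ (hg0 s hs.2).symm) measurableSet_Icc

/-- The paths of an Itô process are almost surely continuous: `X = X₀ + ∫₀ b ds + J` for all
times outside a null set, with `J` a.s. continuous and `t ↦ ∫₀ᵗ b ds` continuous since `b` is
integrable on every `[0, t]`.
Revuz–Yor, *Continuous Martingales and Brownian Motion* (1999), Ch. IV, §3. [folklore] -/
theorem IsItoProcess.ae_continuous (h : IsItoProcess X b σ B 𝓕 P) :
    ∀ᵐ ω ∂P, Continuous (X · ω) := by
  obtain ⟨J, hJ, hXJ⟩ := h.2
  filter_upwards [h.1, hJ.continuous, hXJ] with ω hb hJc hX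
  have hF : Continuous fun x : ℝ ↦ ∫ s in (0 : ℝ)..x, b s.toNNReal ω :=
    intervalIntegral.continuous_primitive
      (intervalIntegrable_of_forall_integrableOn_Icc
        (fun s hs ↦ by simp [Real.toNNReal_of_nonpos hs]) hb) 0
  have heq : (X · ω) = fun t : ℝ≥0 ↦ X 0 ω + (∫ s in (0 : ℝ)..t, b s.toNNReal ω) + J t ω :=
    funext hX
  rw [heq]
  exact (continuous_const.add (hF.comp NNReal.continuous_coe)).add hJc

end ItoProcessPaths

/-! #### Partial derivatives of `f ∈ C²(ℝ × ℝ)` in the `deriv` form of `ito_formula_itoProcess` -/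

section Calculus

variable {f : ℝ → ℝ → ℝ}

/-- For `f ∈ C¹(ℝ × ℝ)` the derivative of the section `x ↦ f t x` is the Fréchet derivative of
`uncurry f` in the direction `(0, 1)`. [folklore] -/
theorem deriv_apply_right_eq_fderiv (hf : ContDiff ℝ 1 (Function.uncurry f)) (t x : ℝ) :
    deriv (f t) x = fderiv ℝ (Function.uncurry f) (t, x) (0, 1) := by
  have hF : HasFDerivAt (Function.uncurry f) (fderiv ℝ (Function.uncurry f) (t, x)) (t, x) :=
    (hf.differentiable one_ne_zero (t, x)).hasFDerivAt
  have hγ : HasDerivAt (fun y : ℝ ↦ (t, y)) ((0 : ℝ), (1 : ℝ)) x :=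
    (hasDerivAt_const x t).prodMk (hasDerivAt_id x)
  exact (hF.comp_hasDerivAt x hγ).deriv

/-- For `f ∈ C¹(ℝ × ℝ)` the derivative of the section `s ↦ f s x` is the Fréchet derivative of
`uncurry f` in the direction `(1, 0)`. [folklore] -/
theorem deriv_apply_left_eq_fderiv (hf : ContDiff ℝ 1 (Function.uncurry f)) (t x : ℝ) :
    deriv (fun s ↦ f s x) t = fderiv ℝ (Function.uncurry f) (t, x) (1, 0) := by
  have hF : HasFDerivAt (Function.uncurry f) (fderiv ℝ (Function.uncurry f) (t, x)) (t, x) :=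
    (hf.differentiable one_ne_zero (t, x)).hasFDerivAt
  have hγ : HasDerivAt (fun s : ℝ ↦ (s, x)) ((1 : ℝ), (0 : ℝ)) t :=
    (hasDerivAt_id t).prodMk (hasDerivAt_const t x)
  exact (hF.comp_hasDerivAt t hγ).deriv

/-- For `f ∈ C²(ℝ × ℝ)` the second derivative of the section `x ↦ f t x` is the second Fréchet
derivative of `uncurry f` in the direction `(0, 1)`, twice. [folklore] -/
theorem iteratedDeriv_two_apply_right_eq_fderiv (hf : ContDiff ℝ 2 (Function.uncurry f))
    (t x : ℝ) :
    iteratedDeriv 2 (f t) x =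
      fderiv ℝ (fderiv ℝ (Function.uncurry f)) (t, x) (0, 1) (0, 1) := by
  have h1 : ContDiff ℝ 1 (Function.uncurry f) := hf.of_le (by norm_num)
  have hd : deriv (f t) = fun y ↦ fderiv ℝ (Function.uncurry f) (t, y) (0, 1) :=
    funext fun y ↦ deriv_apply_right_eq_fderiv h1 t y
  rw [iteratedDeriv_succ, iteratedDeriv_one, hd]
  have hF1 : ContDiff ℝ 1 (fderiv ℝ (Function.uncurry f)) := hf.fderiv_right (by norm_num)
  have hF : HasFDerivAt (fderiv ℝ (Function.uncurry f))
      (fderiv ℝ (fderiv ℝ (Function.uncurry f)) (t, x)) (t, x) :=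
    (hF1.differentiable one_ne_zero (t, x)).hasFDerivAt
  have hγ : HasDerivAt (fun y : ℝ ↦ (t, y)) ((0 : ℝ), (1 : ℝ)) x :=
    (hasDerivAt_const x t).prodMk (hasDerivAt_id x)
  have happ := (hF.comp_hasDerivAt x hγ).clm_apply (hasDerivAt_const x ((0 : ℝ), (1 : ℝ)))
  simp only [ContinuousLinearMap.map_zero, add_zero] at happ
  exact happ.deriv

/-- Joint continuity of `(t, x) ↦ ∂ₓ f(t, x)` for `f ∈ C¹(ℝ × ℝ)`, in `deriv` form. [folklore] -/
theorem continuous_deriv_apply_right (hf : ContDiff ℝ 1 (Function.uncurry f)) :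
    Continuous fun p : ℝ × ℝ ↦ deriv (f p.1) p.2 := by
  have : (fun p : ℝ × ℝ ↦ deriv (f p.1) p.2) =
      fun p ↦ fderiv ℝ (Function.uncurry f) p (0, 1) := by
    funext p; exact deriv_apply_right_eq_fderiv hf p.1 p.2
  rw [this]
  exact (hf.continuous_fderiv one_ne_zero).clm_apply continuous_const

/-- Joint continuity of `(t, x) ↦ ∂ₜ f(t, x)` for `f ∈ C¹(ℝ × ℝ)`, in `deriv` form. [folklore] -/
theorem continuous_deriv_apply_left (hf : ContDiff ℝ 1 (Function.uncurry f)) :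
    Continuous fun p : ℝ × ℝ ↦ deriv (fun s ↦ f s p.2) p.1 := by
  have : (fun p : ℝ × ℝ ↦ deriv (fun s ↦ f s p.2) p.1) =
      fun p ↦ fderiv ℝ (Function.uncurry f) p (1, 0) := by
    funext p; exact deriv_apply_left_eq_fderiv hf p.1 p.2
  rw [this]
  exact (hf.continuous_fderiv one_ne_zero).clm_apply continuous_const

/-- Joint continuity of `(t, x) ↦ ∂ₓₓ f(t, x)` for `f ∈ C²(ℝ × ℝ)`, in `iteratedDeriv` form.
[folklore] -/
theorem continuous_iteratedDeriv_two_apply_right (hf : ContDiff ℝ 2 (Function.uncurry f)) :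
    Continuous fun p : ℝ × ℝ ↦ iteratedDeriv 2 (f p.1) p.2 := by
  have : (fun p : ℝ × ℝ ↦ iteratedDeriv 2 (f p.1) p.2) =
      fun p ↦ fderiv ℝ (fderiv ℝ (Function.uncurry f)) p (0, 1) (0, 1) := by
    funext p; exact iteratedDeriv_two_apply_right_eq_fderiv hf p.1 p.2
  rw [this]
  have hF1 : ContDiff ℝ 1 (fderiv ℝ (Function.uncurry f)) := hf.fderiv_right (by norm_num)
  exact ((hF1.continuous_fderiv one_ne_zero).clm_apply continuous_const).clm_apply
    continuous_const

end Calculus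

/-! #### The drift and the integrand of Itô's formula along an Itô process -/

section ItoFormulaGlue

variable {X b σ B : ℝ≥0 → Ω → ℝ} {𝓕 : Filtration ℝ≥0 m} {P : Measure Ω} {f : ℝ → ℝ → ℝ}

/-- Along a continuous path, a continuous function of `(t, xₜ)` is continuous in real time (read
through `Real.toNNReal`). [folklore] -/
theorem continuous_comp_path_toNNReal {φ : ℝ × ℝ → ℝ} (hφ : Continuous φ) {x : ℝ≥0 → ℝ}
    (hx : Continuous x) : Continuous fun s : ℝ ↦ φ ((s.toNNReal : ℝ), x s.toNNReal) :=
  hφ.comp ((NNReal.continuous_coe.comp continuous_real_toNNReal).prodMk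
    (hx.comp continuous_real_toNNReal))

/-- **Integrability of the Itô drift.** For `f ∈ C²`, an Itô process `X` with progressively
measurable diffusion coefficient `σ`, the drift
`∂ₜf(s, Xₛ) + bₛ ∂ₓf(s, Xₛ) + ½ σₛ² ∂ₓₓf(s, Xₛ)` of `f(t, Xₜ)` is almost surely integrable on
every `[0, t]`: the paths of `X` are continuous, `b` is locally integrable, and `σ²` is locally
integrable (measurable paths and `∫⁻ σ² < ∞` from the approximating simple processes).
Revuz–Yor, *Continuous Martingales and Brownian Motion* (1999), Ch. IV, Thm (3.3),
Remark 1°. [folklore] -/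
theorem IsItoProcess.ae_integrableOn_itoDrift (hf : ContDiff ℝ 2 (Function.uncurry f))
    (hσ : IsStronglyProgressive 𝓕 σ) (h : IsItoProcess X b σ B 𝓕 P) :
    ∀ᵐ ω ∂P, ∀ t : ℝ≥0, IntegrableOn (fun s : ℝ ↦
      deriv (fun r ↦ f r (X s.toNNReal ω)) (s.toNNReal : ℝ) +
        b s.toNNReal ω * deriv (f (s.toNNReal : ℝ)) (X s.toNNReal ω) +
        2⁻¹ * σ s.toNNReal ω ^ 2 * iteratedDeriv 2 (f (s.toNNReal : ℝ)) (X s.toNNReal ω))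
      (Set.Icc 0 t) := by
  have h1 : ContDiff ℝ 1 (Function.uncurry f) := hf.of_le (by norm_num)
  obtain ⟨J, hJ, -⟩ := h.2
  obtain ⟨Hn, hHn⟩ := hJ.2.2.2.1
  filter_upwards [h.1, h.ae_continuous,
    ae_integrableOn_sq_of_isApproxSeq hHn (measurable_path_of_isStronglyProgressive hσ)]
    with ω hb hXc hσ2 t
  refine IntegrableOn.add (IntegrableOn.add ?_ ?_) ?_
  · exact (continuous_comp_path_toNNReal (continuous_deriv_apply_left h1) hXc).integrableOn_Icc
  · exact (hb t).mul_continuousOn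
      (continuous_comp_path_toNNReal (continuous_deriv_apply_right h1) hXc).continuousOn
      isCompact_Icc
  · exact (show IntegrableOn (fun s : ℝ ↦ 2⁻¹ * σ s.toNNReal ω ^ 2) (Set.Icc 0 t) volume from
        (hσ2 t).const_mul 2⁻¹).mul_continuousOn
      (continuous_comp_path_toNNReal (continuous_iteratedDeriv_two_apply_right hf) hXc).continuousOn
      isCompact_Icc

/-- The integrand `∂ₓf(t, Xₜ)` of Itô's formula is adapted when `X` is. [folklore] -/
theorem adapted_deriv_apply (hf : ContDiff ℝ 1 (Function.uncurry f)) (hXa : Adapted 𝓕 X) :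
    Adapted 𝓕 fun t ω ↦ deriv (f t) (X t ω) := fun t ↦
  ((continuous_deriv_apply_right hf).comp
    (continuous_const.prodMk continuous_id)).measurable.comp (hXa t)

/-- The integrand `∂ₓf(t, Xₜ)` of Itô's formula has a.s. continuous paths along an Itô process.
[folklore] -/
theorem IsItoProcess.ae_continuous_deriv_apply (hf : ContDiff ℝ 1 (Function.uncurry f))
    (h : IsItoProcess X b σ B 𝓕 P) :
    ∀ᵐ ω ∂P, Continuous fun t : ℝ≥0 ↦ deriv (f t) (X t ω) := by
  filter_upwards [h.ae_continuous] with ω hXc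
  exact (continuous_deriv_apply_right hf).comp (NNReal.continuous_coe.prodMk hXc)

end ItoFormulaGlue

/-! #### Changing the integrand on a null set -/

section Congr

variable {𝓕 : Filtration ℝ≥0 m} {P : Measure Ω} {H H' B J : ℝ≥0 → Ω → ℝ}

/-- The approximation mode `SimpleProcess.IsApproxSeq` only depends on the integrand up to a
`P`-null set of paths. [folklore] -/
theorem _root_.Literature.Probability.Process.SimpleProcess.isApproxSeq_congr_ae {Hn : ℕ → Literature.Probability.Process.SimpleProcess m 𝓕}
    (hH : ∀ᵐ ω ∂P, ∀ t, H t ω = H' t ω) :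
    Literature.Probability.Process.SimpleProcess.IsApproxSeq Hn H P ↔ Literature.Probability.Process.SimpleProcess.IsApproxSeq Hn H' P := by
  have key : ∀ (n : ℕ) (t : ℝ≥0) (ε : ℝ),
      P {ω | ENNReal.ofReal ε ≤ ∫⁻ s in Set.Icc (0 : ℝ) t,
          ENNReal.ofReal (((Hn n).toProcess s.toNNReal ω - H s.toNNReal ω) ^ 2)} =
        P {ω | ENNReal.ofReal ε ≤ ∫⁻ s in Set.Icc (0 : ℝ) t,
          ENNReal.ofReal (((Hn n).toProcess s.toNNReal ω - H' s.toNNReal ω) ^ 2)} := by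
    intro n t ε
    refine measure_congr ?_
    filter_upwards [hH] with ω hω
    simp only [eq_iff_iff]
    show ω ∈ {ω | _} ↔ ω ∈ {ω | _}
    simp only [Set.mem_setOf_eq, hω]
  simp only [Literature.Probability.Process.SimpleProcess.IsApproxSeq, key]

/-- `IsItoIntegral` only depends on the integrand up to a `P`-null set of paths. [folklore] -/
theorem _root_.Literature.Probability.Process.IsItoIntegral.congr_integrand_ae (h : Literature.Probability.Process.IsItoIntegral H B J 𝓕 P)
    (hH : ∀ᵐ ω ∂P, ∀ t, H t ω = H' t ω) : Literature.Probability.Process.IsItoIntegral H' B J 𝓕 P := by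
  obtain ⟨h0, hc, hm, ⟨Hn, hHn⟩, hall⟩ := h
  refine ⟨h0, hc, hm, ⟨Hn, (Literature.Probability.Process.SimpleProcess.isApproxSeq_congr_ae hH).1 hHn⟩, fun Kn hKn ↦ ?_⟩
  exact hall Kn ((Literature.Probability.Process.SimpleProcess.isApproxSeq_congr_ae hH).2 hKn)

end Congr

/-! #### Existence of the Itô integral of `σ g`, `g` adapted continuous -/

/-- **Stochastic integral of a continuous adapted multiple of an Itô integrand.** Given the
existence fact `exists_isItoIntegral` (progressive integrands with `∫₀ᵗ H² ds < ∞` a.s. admit an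
Itô integral against the canonical Brownian motion), if `σ` is progressively measurable and
admits an Itô integral, and `g` is adapted with a.s. continuous paths, then `σ g` admits an Itô
integral: `σ · g̃` is progressive and locally square integrable for the progressive dyadic
regularisation `g̃` of `g`, and `g̃ = g` off a null set of paths.
Revuz–Yor, *Continuous Martingales and Brownian Motion* (1999), Ch. IV, Prop. (2.7) and
Def. (2.8) (continuous adapted processes are locally bounded; locally bounded progressive
processes times `L²_loc` stay in `L²_loc`). [folklore] -/
theorem exists_isItoIntegral_mul_of_continuous (hex : Literature.Probability.Process.exists_isItoIntegral)
    {σ g J : ℝ≥0 → (ℝ≥0 → ℝ) → ℝ} (hσ : IsStronglyProgressive Literature.Probability.RandomPlanarGeometry.brownianFiltration σ)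
    (hJ : Literature.Probability.Process.IsItoIntegral σ Literature.Probability.Process.brownian J Literature.Probability.RandomPlanarGeometry.brownianFiltration Literature.Probability.Process.preWienerMeasure)
    (hga : Adapted Literature.Probability.RandomPlanarGeometry.brownianFiltration g)
    (hgc : ∀ᵐ ω ∂Literature.Probability.Process.preWienerMeasure, Continuous (g · ω)) :
    ∃ K, Literature.Probability.Process.IsItoIntegral (fun t ω ↦ σ t ω * g t ω) Literature.Probability.Process.brownian K Literature.Probability.RandomPlanarGeometry.brownianFiltration
      Literature.Probability.Process.preWienerMeasure := by
  have hg' : IsStronglyProgressive Literature.Probability.RandomPlanarGeometry.brownianFiltration (dyadicReg g) :=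
    isStronglyProgressive_dyadicReg hga
  have hint : ∀ t : ℝ≥0, ∀ᵐ ω ∂Literature.Probability.Process.preWienerMeasure, IntegrableOn
      (fun s : ℝ ↦ (σ s.toNNReal ω * dyadicReg g s.toNNReal ω) ^ 2) (Set.Icc 0 t) := by
    intro t
    obtain ⟨Hn, hHn⟩ := hJ.2.2.2.1
    filter_upwards [ae_integrableOn_sq_of_isApproxSeq hHn
      (measurable_path_of_isStronglyProgressive hσ), hgc] with ω hσ2 hgc
    have heq : (fun s : ℝ ↦ (σ s.toNNReal ω * dyadicReg g s.toNNReal ω) ^ 2) =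
        fun s ↦ σ s.toNNReal ω ^ 2 * g s.toNNReal ω ^ 2 := by
      funext s; rw [dyadicReg_apply_of_continuous hgc, mul_pow]
    rw [heq]
    exact (hσ2 t).mul_continuousOn
      (((continuous_pow 2).comp (hgc.comp continuous_real_toNNReal)).continuousOn)
      isCompact_Icc
  obtain ⟨K, hK⟩ := hex (hσ.mul hg') hint
  refine ⟨K, hK.congr_integrand_ae ?_⟩
  filter_upwards [hgc] with ω hω t
  rw [dyadicReg_apply_of_continuous hω]

/-! #### Assembly -/

/-- **Reduction of Itô's formula for Itô processes** (`ito_formula_itoProcess_of_progressive`)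
to the existence of Itô integrals of progressive `L²_loc` integrands (`exists_isItoIntegral`,
Revuz–Yor Ch. IV Prop. (2.7)) and Itô's formula proper in integrated form
(`ito_formula_itoProcess_ae`, Revuz–Yor Ch. IV Thm (3.3), Remark 1°): the drift is a.s. locally
integrable (`IsItoProcess.ae_integrableOn_itoDrift`), the integrand `σₜ ∂ₓf(t, Xₜ)` admits an
Itô integral `K` (`exists_isItoIntegral_mul_of_continuous`), and the formula identifies
`f(t, Xₜ)` as `f(0, X₀) + ∫₀ᵗ drift ds + Kₜ`.
Revuz–Yor, *Continuous Martingales and Brownian Motion* (1999), Ch. IV, Thm (3.3) and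
Remark 1°, Prop. (2.7). [folklore] -/
theorem ito_formula_itoProcess_of_progressive_of_facts
    (hex : Literature.Probability.Process.exists_isItoIntegral) (hito : ito_formula_itoProcess_ae) :
    ito_formula_itoProcess_of_progressive := by
  intro X b σ f hf hXa hσ hX
  have h1 : ContDiff ℝ 1 (Function.uncurry f) := hf.of_le (by norm_num)
  obtain ⟨J, hJ, -⟩ := hX.2
  obtain ⟨K, hK⟩ := exists_isItoIntegral_mul_of_continuous hex hσ hJ (adapted_deriv_apply h1 hXa)
    (hX.ae_continuous_deriv_apply h1)
  exact ⟨hX.ae_integrableOn_itoDrift hf hσ, K, hK, hito f hf hXa hσ hX hK⟩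

end Literature.Analysis.FunctionSpaces
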